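import Mathlib.GroupTheory.QuotientGroup.Basic
import Mathlib.GroupTheory.Index
import Literature.Computability.Complexity.EquivalenceProblems
import Literature.Computability.Cryptography.ShorStepFP
import Literature.Computability.QuantumComplexity.FactoringProofs
import Literature.Computability.QuantumComplexity.FactoringPrimesProofs
import HarnessLib

/-!
# Fortnow–Grochow 2011, Prop. 4.10: an `FP` canonical form for the Rabin kernel factors integers
(`fortnowGrochow_rabinKernel_factoring_holds`)

Sibling proof file (D-0014 append protocol; proved helper definitions and theorems only) of
`Literature/Computability/Complexity/EquivalenceProblems.lean`, discharging the named fact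
`fortnowGrochow_rabinKernel_factoring`:

> an `FP` canonical form `c` for the kernel `{(⟨N,x⟩, ⟨N,y⟩) : x² ≡ y² (mod N)}` of the Rabin
> function `rabinFn` puts `FACT = {⟨N, k⟩ : ∃ d, 1 < d ≤ k, d ∣ N}` in `ZPP = RP ∩ coRP`.

We follow the printed proof [FG11, proof of Prop. 4.10, p. 10 of arXiv:0907.4775]: "Randomly
choose `x ∈ ℤ/Nℤ` and let `y = f(x)`. Then `x² ≡ y²`; if `y ≢ ±x` then `gcd(N, x - y)` is a
nontrivial factor … `Pr_x[y ≢ ±x] ≥ 1 - 2/r(N) ≥ 1/2` since `N` is composite and odd without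
loss of generality … Recursively call the algorithm on `N/z`", primality being decided in
polynomial time by AKS. The formalisation reuses the tree's machinery for the classical part of
Shor's algorithm (`Cryptography/ShorFactoring.lean`, `ShorRoundFP.lean`, `ShorStepFP.lean`),
which is exactly such a recursive randomised splitting driver, with Shor's order-finding step
replaced by the Rabin step:

* **The Rabin step** (`FGRabin.rabinSplit Y m X`): even `m` / perfect powers as in Shor's driver;
  otherwise draw `x = X mod 2^{size m}`, fail on `x = 0 ∨ x ≥ m`, return `gcd(x, m)` for a
  non-unit, else `g = gcd(x + y, m)` with `y = Y m x` the square root supplied by the canonical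
  form, returned when `1 < g < m`. `rabinSplit_sound`; `rabinSplit_fail_card`: at most `5/6` of
  the blocks `X < 2^B` fail for composite `m` — the heart being `FGRabin.two_mul_card_badRabin_le`:
  the units `x` with `y ≡ ±x` are at most `φ(m)/2`, because `x ↦ x·K` (`K` the square roots of
  unity, `|K| ≥ 4` for odd `m` with two distinct prime factors, by CRT) is injective on each of
  `{y ≡ x}`, `{y ≡ -x}` (the printed "`Pr_x[y ≢ ±x] ≥ 1 - 2/r(N)`").
* **The driver** (`FGRabin.gstep`/`grun`, generic in a sound splitting step): a verbatim transport
  of `Shor1997.wstep`/`wrun` with its invariants, potential, episode dichotomy and cylinder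
  counting (`grun_dichotomy`, `card_gfail_le`, `uniformProb_gfail_le`), and the success bound
  `rabinClassical_success` (`≥ 3/4` with `64(|x|+1)³` coins).
* **Polynomial time** (`FGRabinFP`): the round function `roundG c` in the brick algebra on the
  seven-field records of `ShorRoundFP` (answers and status fields kept empty), its growth
  (`length_roundG_le`), the rounds (`iterG`), the initial record and the read-out; `driverOutF c ∈ FP`
  computes the code of the sorted list of numbers declared prime (`driverOutF_apply`).
* **Assembly**: the `RP` verifier accepts `⟨x, r⟩` iff `x = ⟨N, k⟩` is a valid instance and
  (`N = 0 ∧ 2 ≤ k`, or the head of the driver's output is a divisor `1 < d ≤ k` of `N`); the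
  `coRP` verifier accepts iff the instance is malformed, or degenerate, or the driver's output is
  a list of AKS-certified primes `> k` with product `N` (`aksFn`, `PRIMES ∈ P`). No false
  positives on either side; completeness from `rabinClassical_success`. Hence `FACT ∈ RP ∩ coRP`.

## References

* L. Fortnow, J. A. Grochow, *Complexity classes of equivalence problems revisited*, Inform.
  Comput. 209 (2011) 748–763 = arXiv:0907.4775, Prop. 4.10 and its proof [FortnowGrochow2011].
* M. O. Rabin, *Digitalized signatures and public-key functions as intractable as
  factorization*, MIT/LCS/TR-212 (1979) (the kernel of `x ↦ x² mod N` and factoring).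
* M. Agrawal, N. Kayal, N. Saxena, *PRIMES is in P*, Ann. of Math. 160 (2004) 781–793.
* P. W. Shor, SIAM J. Comput. 26 (1997) 1484–1509, §5 (the recursive randomised driver, as
  formalised in `Cryptography/ShorFactoring.lean`).
-/

noncomputable section

namespace Literature.Computability.Complexity

open _root_.Computability
open Literature.Computability.Cryptography
open Literature.Computability.Cryptography.Shor1997 (ppBase ppBase_spec ppBase_le ppBase_dvd one_lt_ppBase
  two_le_card_primeFactors WState winit Inv1 Inv2 pot pot_winit one_le_pot inv1_winit inv2_winit
  one_le_cardFactors cardFactors_add_cardFactors_div two_pow_cardFactors_le blockLen budget rounds coinLen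
  coinLen_eq rounds_mul_pow_le pot_winit_le_rounds unitsEquivPi unitsEquivPi_neg_one two_lt_PP)

namespace FGRabin

/-! ### Square roots of unity and the count of bad units -/

section BadUnits

open Finset

variable {m : ℕ}

/-- For odd `m` with at least two distinct prime factors there are at least four square roots of
unity among the units modulo `m` (the sign vectors `(±1, ±1, …)` under the Chinese remainder
isomorphism). [cite: FortnowGrochow2011, Prop. 4.10 (proof: "r(N) ≥ 4")] -/
theorem four_le_card_sqrtOne [NeZero m] (hodd : Odd m) (hk : 2 ≤ m.primeFactors.card) :
    4 ≤ Nat.card ((powMonoidHom 2 : (ZMod m)ˣ →* (ZMod m)ˣ).ker) := by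
  classical
  set K := (powMonoidHom 2 : (ZMod m)ˣ →* (ZMod m)ˣ).ker with hK
  -- the sign vectors
  let sgn : (m.primeFactors → Bool) → (ZMod m)ˣ := fun s =>
    (unitsEquivPi m).symm fun p => if s p then -1 else 1
  have hsq : ∀ s, sgn s ∈ K := by
    intro s
    rw [hK, MonoidHom.mem_ker, powMonoidHom_apply]
    apply (unitsEquivPi m).injective
    rw [map_pow, map_one]
    simp only [sgn, MulEquiv.apply_symm_apply]
    funext p
    simp only [Pi.pow_apply, Pi.one_apply]
    split_ifs <;> simp
  have hinj : Function.Injective sgn := by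
    intro s s' h
    have h' := congrArg (unitsEquivPi m) h
    simp only [sgn, MulEquiv.apply_symm_apply] at h'
    funext p
    have hp := congrFun h' p
    haveI : Fact (2 < Shor1997.PP m p) := ⟨two_lt_PP m hodd p⟩
    have hne : (-1 : (ZMod (Shor1997.PP m p))ˣ) ≠ 1 := fun e =>
      ZMod.neg_one_ne_one (n := Shor1997.PP m p) (by simpa using congrArg Units.val e)
    cases hs : s p <;> cases hs' : s' p <;> simp [hs, hs'] at hp ⊢
    · exact hne hp.symm
    · exact hne hp
  -- an injection of `2 ^ k ≥ 4` sign vectors into `K`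
  let ι : (m.primeFactors → Bool) → K := fun s => ⟨sgn s, hsq s⟩
  have hι : Function.Injective ι := fun s s' h => hinj (by simpa [ι] using congrArg Subtype.val h)
  haveI : Fintype K := Fintype.ofFinite K
  have hcard := Fintype.card_le_of_injective ι hι
  rw [Fintype.card_fun, Fintype.card_bool, Fintype.card_coe] at hcard
  rw [Nat.card_eq_fintype_card]
  calc 4 = 2 ^ 2 := rfl
    _ ≤ 2 ^ m.primeFactors.card := Nat.pow_le_pow_right (by norm_num) hk
    _ ≤ Fintype.card K := hcard

/-- The *bad residues* of the Rabin step for a square-root table `y : ℕ → ℕ` modulo `m`: units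
`0 < x < m` with `y x ≡ x` or `y x ≡ -x (mod m)`.
[cite: FortnowGrochow2011, Prop. 4.10 (proof: the event "y ≡ ±x")] -/
def badRabin (m : ℕ) (y : ℕ → ℕ) : Finset ℕ :=
  (Finset.range m).filter fun x => 0 < x ∧ x.Coprime m ∧
    ((y x : ZMod m) = x ∨ (y x : ZMod m) = -(x : ZMod m))

/-- **At most half of the units are bad** ("`Pr_x[y ≢ ±x] ≥ 1 - 2/r(N)`" with `r(N) ≥ 4`): if
`y x` depends only on `x² mod m`, then on each of the two sets `{y x ≡ x}`, `{y x ≡ -x}` the map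
`x ↦ x · K` to the cosets of the square roots of unity `K` is injective, so each has at most
`|(ℤ/m)ˣ| / |K| ≤ φ(m)/4` elements. [cite: FortnowGrochow2011, Prop. 4.10 (proof)] -/
theorem two_mul_card_badRabin_le (hm : 1 < m) (hodd : Odd m) (hk : 2 ≤ m.primeFactors.card)
    {y : ℕ → ℕ} (hy : ∀ x x', x ^ 2 % m = x' ^ 2 % m → y x = y x') :
    2 * (badRabin m y).card ≤ Nat.totient m := by
  classical
  haveI : NeZero m := ⟨by omega⟩
  set f := (powMonoidHom 2 : (ZMod m)ˣ →* (ZMod m)ˣ) with hf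
  set K := f.ker with hK
  haveI : Fintype K := Fintype.ofFinite K
  -- the quotient by `K`
  have hKcard : Nat.card (ZMod m)ˣ = Nat.card ((ZMod m)ˣ ⧸ K) * Nat.card K :=
    Subgroup.card_eq_card_quotient_mul_card_subgroup K
  have h4 : 4 ≤ Nat.card K := four_le_card_sqrtOne hodd hk
  haveI : Fintype ((ZMod m)ˣ ⧸ K) := Fintype.ofFinite _
  -- the unit of a coprime residue
  let u : ℕ → (ZMod m)ˣ := fun x => if h : x.Coprime m then ZMod.unitOfCoprime x h else 1
  have hu : ∀ {x}, x.Coprime m → ((u x : (ZMod m)ˣ) : ZMod m) = x := by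
    intro x hx; simp only [u, dif_pos hx, ZMod.coe_unitOfCoprime]
  -- two cosets agree iff the squares agree
  have hcoset : ∀ {x x' : ℕ}, x.Coprime m → x'.Coprime m →
      (QuotientGroup.mk (s := K) (u x) : (ZMod m)ˣ ⧸ K) = QuotientGroup.mk (u x') → x ^ 2 % m = x' ^ 2 % m := by
    intro x x' hx hx' h
    rw [QuotientGroup.eq] at h
    rw [hK, MonoidHom.mem_ker, hf, powMonoidHom_apply, mul_pow, inv_pow] at h
    have h2 : (u x) ^ 2 = (u x') ^ 2 := by
      rw [inv_mul_eq_one] at h; exact h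
    have h3 : ((x : ZMod m)) ^ 2 = ((x' : ZMod m)) ^ 2 := by
      have := congrArg (fun w : (ZMod m)ˣ => (w : ZMod m)) h2
      simpa [Units.val_pow_eq_pow_val, hu hx, hu hx'] using this
    rw [← ZMod.natCast_eq_natCast_iff']
    push_cast
    exact h3
  -- the two halves
  let Bp : Finset ℕ := (Finset.range m).filter fun x => 0 < x ∧ x.Coprime m ∧ (y x : ZMod m) = x
  let Bm : Finset ℕ := (Finset.range m).filter fun x => 0 < x ∧ x.Coprime m ∧ (y x : ZMod m) = -(x : ZMod m)
  have hsub : badRabin m y ⊆ Bp ∪ Bm := by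
    intro x hx
    simp only [badRabin, mem_filter, mem_range] at hx
    simp only [Bp, Bm, mem_union, mem_filter, mem_range]
    rcases hx.2.2.2 with h | h
    · exact Or.inl ⟨hx.1, hx.2.1, hx.2.2.1, h⟩
    · exact Or.inr ⟨hx.1, hx.2.1, hx.2.2.1, h⟩
  have hquot : Fintype.card ((ZMod m)ˣ ⧸ K) * 4 ≤ Nat.totient m := by
    have e1 : Nat.card (ZMod m)ˣ = Nat.totient m := by
      rw [Nat.card_eq_fintype_card, ZMod.card_units_eq_totient]
    rw [← e1, hKcard, ← Nat.card_eq_fintype_card]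
    exact Nat.mul_le_mul_left _ h4
  -- injectivity of `x ↦ x·K` on each half
  have hBp : Bp.card ≤ Fintype.card ((ZMod m)ˣ ⧸ K) := by
    rw [← Finset.card_univ]
    refine Finset.card_le_card_of_injOn (fun x => QuotientGroup.mk (u x)) (fun _ _ => mem_univ _) ?_
    intro x hx x' hx' h
    simp only [Bp, coe_filter, mem_range, Set.mem_setOf_eq] at hx hx'
    have hsqm := hcoset hx.2.2.1 hx'.2.2.1 h
    have hyy := hy x x' hsqm
    have : (x : ZMod m) = x' := by rw [← hx.2.2.2, ← hx'.2.2.2, hyy]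
    rw [ZMod.natCast_eq_natCast_iff', Nat.mod_eq_of_lt hx.1, Nat.mod_eq_of_lt hx'.1] at this
    exact this
  have hBm : Bm.card ≤ Fintype.card ((ZMod m)ˣ ⧸ K) := by
    rw [← Finset.card_univ]
    refine Finset.card_le_card_of_injOn (fun x => QuotientGroup.mk (u x)) (fun _ _ => mem_univ _) ?_
    intro x hx x' hx' h
    simp only [Bm, coe_filter, mem_range, Set.mem_setOf_eq] at hx hx'
    have hsqm := hcoset hx.2.2.1 hx'.2.2.1 h
    have hyy := hy x x' hsqm
    have : (x : ZMod m) = x' := by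
      have e := hx.2.2.2
      have e' := hx'.2.2.2
      rw [hyy] at e
      exact neg_injective (e.symm.trans e')
    rw [ZMod.natCast_eq_natCast_iff', Nat.mod_eq_of_lt hx.1, Nat.mod_eq_of_lt hx'.1] at this
    exact this
  calc 2 * (badRabin m y).card ≤ 2 * (Bp ∪ Bm).card := Nat.mul_le_mul_left _ (card_le_card hsub)
    _ ≤ 2 * (Bp.card + Bm.card) := Nat.mul_le_mul_left _ (card_union_le _ _)
    _ ≤ 2 * (2 * Fintype.card ((ZMod m)ˣ ⧸ K)) := by omega
    _ ≤ Nat.totient m := by linarith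

end BadUnits

/-! ### The Rabin splitting step -/

section Step

open Finset

/-- **One attempt of the printed reduction**, driven by a random block value `X` and a
square-root table `Y` (`Y x` a square root of `x²` modulo `m`, supplied by the canonical form):
even `m ≠ 2` yields `2`; a nontrivial perfect power yields its least root; otherwise
`x = X mod 2^{size m}` is drawn, `x = 0` or `x ≥ m` fails, a non-unit yields `gcd(x, m)`, and a
unit yields `g = gcd(x + y, m)` if `1 < g < m` ("if `y ≢ ±x` then `gcd(N, x - y)` is a nontrivial
factor"; we use the cofactor `x + y`, which avoids subtraction), failing otherwise.
[cite: FortnowGrochow2011, Prop. 4.10 (proof)] -/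
def rabinSplit (Y : ℕ → ℕ) (m X : ℕ) : Option ℕ :=
  if Even m then (if m = 2 then none else some 2)
  else if ppBase m < m then some (ppBase m)
  else
    let x := X % 2 ^ Nat.size m
    if x = 0 ∨ m ≤ x then none
    else if 1 < Nat.gcd x m then some (Nat.gcd x m)
    else
      let g := Nat.gcd (x + Y x) m
      if 1 < g ∧ g < m then some g else none

/-- **Soundness of one attempt**: a returned number is a nontrivial divisor of `m`.
[cite: FortnowGrochow2011, Prop. 4.10 (proof)] -/
theorem rabinSplit_sound {Y : ℕ → ℕ} {m X d : ℕ} (hm : 1 < m) (h : rabinSplit Y m X = some d) :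
    1 < d ∧ d < m ∧ d ∣ m := by
  unfold rabinSplit at h
  dsimp only at h
  split_ifs at h with h1 h2 h3 h4 h5 h6
  · cases Option.some.inj h
    obtain ⟨c, hc⟩ := h1
    exact ⟨by omega, by omega, ⟨c, by omega⟩⟩
  · cases Option.some.inj h
    exact ⟨one_lt_ppBase hm, h3, ppBase_dvd m⟩
  · cases Option.some.inj h
    push Not at h4
    exact ⟨h5, lt_of_le_of_lt (Nat.gcd_le_left _ (Nat.pos_of_ne_zero h4.1)) h4.2, Nat.gcd_dvd_right _ _⟩
  · cases Option.some.inj h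
    exact ⟨h6.1, h6.2, Nat.gcd_dvd_right _ _⟩

/-- **The gcd criterion**: for a unit `x` modulo `m ≥ 2` and `y² ≡ x²`, if `g = gcd(x + y, m)` is
not a nontrivial divisor then `y ≡ x` (`g = 1`: `x + y` is a unit and `(x+y)(x-y) ≡ 0`) or
`y ≡ -x` (`g = m`). [cite: FortnowGrochow2011, Prop. 4.10 (proof: "(x-y)(x+y) ≡ 0 (mod N)")] -/
theorem sq_root_dichotomy {m x y : ℕ} (hm : 1 < m) (hsq : y ^ 2 % m = x ^ 2 % m)
    (hg : ¬ (1 < Nat.gcd (x + y) m ∧ Nat.gcd (x + y) m < m)) :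
    (y : ZMod m) = x ∨ (y : ZMod m) = -(x : ZMod m) := by
  haveI : NeZero m := ⟨by omega⟩
  have hsqZ : ((y : ZMod m)) ^ 2 = ((x : ZMod m)) ^ 2 := by
    rw [← ZMod.natCast_eq_natCast_iff'] at hsq
    push_cast at hsq
    exact hsq
  have hprod : ((x : ZMod m) + y) * ((y : ZMod m) - x) = 0 := by
    have : ((x : ZMod m) + y) * ((y : ZMod m) - x) = (y : ZMod m) ^ 2 - (x : ZMod m) ^ 2 := by ring
    rw [this, hsqZ, sub_self]
  have hgpos : 0 < Nat.gcd (x + y) m := Nat.gcd_pos_of_pos_right _ (by omega)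
  have hgle : Nat.gcd (x + y) m ≤ m := Nat.le_of_dvd (by omega) (Nat.gcd_dvd_right _ _)
  rcases Nat.lt_or_ge 1 (Nat.gcd (x + y) m) with h1 | h1
  · -- `g = m`: `m ∣ x + y`
    have hgm : Nat.gcd (x + y) m = m := by
      by_contra hne
      exact hg ⟨h1, lt_of_le_of_ne hgle hne⟩
    have hdvd : m ∣ x + y := hgm ▸ Nat.gcd_dvd_left _ _
    right
    have h0 : ((x + y : ℕ) : ZMod m) = 0 := (ZMod.natCast_eq_zero_iff _ _).2 hdvd
    push_cast at h0
    exact eq_neg_of_add_eq_zero_left (by rw [add_comm]; exact h0)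
  · -- `g = 1`: `x + y` is a unit
    have hcop : (x + y).Coprime m := by
      have : Nat.gcd (x + y) m = 1 := by omega
      exact this
    left
    have hunit : IsUnit (((x + y : ℕ) : ZMod m)) := by
      rw [← ZMod.coe_unitOfCoprime _ hcop]; exact Units.isUnit _
    push_cast at hunit
    have := hunit.mul_right_eq_zero.1 hprod
    exact (sub_eq_zero.1 this)

/-- A failed attempt on an odd non-perfect-power `m` comes from a draw `x = 0`, `x ≥ m`, or a bad
residue (`y ≡ ±x`); non-units never fail. [cite: FortnowGrochow2011, Prop. 4.10 (proof)] -/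
theorem rabinSplit_eq_none_imp {Y : ℕ → ℕ} {m X : ℕ} (hm : 1 < m) (hodd : ¬ Even m) (hpp : ¬ ppBase m < m)
    (hY : ∀ x, (Y x) ^ 2 % m = x ^ 2 % m) (h : rabinSplit Y m X = none) :
    X % 2 ^ m.size = 0 ∨ m ≤ X % 2 ^ m.size ∨ X % 2 ^ m.size ∈ badRabin m Y := by
  unfold rabinSplit at h
  dsimp only at h
  simp only [hodd, if_false, hpp] at h
  split_ifs at h with h4 h5 h6
  · rcases h4 with h4 | h4
    · exact Or.inl h4
    · exact Or.inr (Or.inl h4)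
  · push Not at h4 h5
    right; right
    simp only [badRabin, Finset.mem_filter, Finset.mem_range]
    have hpos : 0 < Nat.gcd (X % 2 ^ m.size) m := Nat.gcd_pos_of_pos_left _ (by omega)
    refine ⟨h4.2, by omega, le_antisymm h5 hpos, ?_⟩
    exact sq_root_dichotomy hm (hY _) h6

/-- **Failure probability of one attempt** ("`Pr_x[y ≢ ±x] ≥ 1/2`" for odd composite `N`, here
combined with the draw of `x < 2^{size m}`, which lands in `[1, m)` with probability `> 1/3`): for
composite `m > 1` and any block length `B ≥ size m`, at most `5/6` of the block values `X < 2^B`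
fail. [cite: FortnowGrochow2011, Prop. 4.10 (proof)] -/
theorem rabinSplit_fail_card {Y : ℕ → ℕ} {m B : ℕ} (hm : 1 < m) (hp : ¬ m.Prime) (hB : m.size ≤ B)
    (hY₁ : ∀ x, (Y x) ^ 2 % m = x ^ 2 % m) (hY₂ : ∀ x x', x ^ 2 % m = x' ^ 2 % m → Y x = Y x') :
    6 * ((Finset.range (2 ^ B)).filter fun X => rabinSplit Y m X = none).card ≤ 5 * 2 ^ B := by
  by_cases heven : Even m
  · have : ((Finset.range (2 ^ B)).filter fun X => rabinSplit Y m X = none) = ∅ := by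
      refine Finset.filter_false_of_mem fun X _ => ?_
      have hm2 : m ≠ 2 := fun h2 => hp (h2 ▸ Nat.prime_two)
      simp [rabinSplit, heven, hm2]
    rw [this]; simp
  by_cases hpp : ppBase m < m
  · have : ((Finset.range (2 ^ B)).filter fun X => rabinSplit Y m X = none) = ∅ := by
      refine Finset.filter_false_of_mem fun X _ => ?_
      simp [rabinSplit, heven, hpp]
    rw [this]; simp
  -- the main case: `m` odd, composite, not a perfect power
  have hodd : Odd m := Nat.not_even_iff_odd.1 heven
  have hm3 : 3 ≤ m := by
    obtain ⟨c, hc⟩ := hodd; omega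
  have hms : m < 2 ^ m.size := Nat.lt_size_self m
  have h2s : 2 ^ m.size ≤ 2 * m := by
    have hspos : 0 < m.size := Nat.size_pos.2 (by omega)
    have : 2 ^ (m.size - 1) ≤ m := Nat.lt_size.1 (by omega)
    calc 2 ^ m.size = 2 * 2 ^ (m.size - 1) := by rw [← pow_succ']; congr 1; omega
      _ ≤ 2 * m := by omega
  -- count modulo `2 ^ size m`
  have hsub : ((Finset.range (2 ^ m.size)).filter fun x => rabinSplit Y m x = none) ⊆
      {0} ∪ Finset.Ico m (2 ^ m.size) ∪ badRabin m Y := by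
    intro x hx
    simp only [Finset.mem_filter, Finset.mem_range] at hx
    have hxs : x % 2 ^ m.size = x := Nat.mod_eq_of_lt hx.1
    have := rabinSplit_eq_none_imp hm heven hpp hY₁ hx.2
    rw [hxs] at this
    simp only [Finset.mem_union, Finset.mem_singleton, Finset.mem_Ico]
    rcases this with h0 | hle | hbad
    · exact Or.inl (Or.inl h0)
    · exact Or.inl (Or.inr ⟨hle, hx.1⟩)
    · exact Or.inr hbad
  have hcard : 6 * ((Finset.range (2 ^ m.size)).filter fun x => rabinSplit Y m x = none).card ≤
      5 * 2 ^ m.size := by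
    have hc := Finset.card_le_card hsub
    have hu1 := Finset.card_union_le ({0} ∪ Finset.Ico m (2 ^ m.size)) (badRabin m Y)
    have hu2 := Finset.card_union_le ({0} : Finset ℕ) (Finset.Ico m (2 ^ m.size))
    rw [Finset.card_singleton, Nat.card_Ico] at hu2
    have hbad := two_mul_card_badRabin_le hm hodd (two_le_card_primeFactors hm hp hpp) hY₂
    have htot := Nat.totient_lt m hm
    omega
  -- lift to `B` bits through `X ↦ X % 2 ^ size m`
  have hsplit : ∀ X, rabinSplit Y m X = rabinSplit Y m (X % 2 ^ m.size) := by
    intro X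
    simp only [rabinSplit, Nat.mod_mod]
  obtain ⟨e, rfl⟩ := Nat.exists_eq_add_of_le hB
  rw [show 2 ^ (m.size + e) = 2 ^ e * 2 ^ m.size by rw [pow_add, mul_comm]]
  have hcongr : ((Finset.range (2 ^ e * 2 ^ m.size)).filter fun X => rabinSplit Y m X = none) =
      (Finset.range (2 ^ e * 2 ^ m.size)).filter fun X => rabinSplit Y m (X % 2 ^ m.size) = none :=
    Finset.filter_congr fun X _ => by rw [← hsplit]
  rw [hcongr, card_filter_range_mul_mod (2 ^ e) (2 ^ m.size) (fun x => rabinSplit Y m x = none)]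
  calc 6 * (2 ^ e * ((Finset.range (2 ^ m.size)).filter fun x => rabinSplit Y m x = none).card)
      = 2 ^ e * (6 * ((Finset.range (2 ^ m.size)).filter fun x => rabinSplit Y m x = none).card) := by
        ring
    _ ≤ 2 ^ e * (5 * 2 ^ m.size) := Nat.mul_le_mul_left _ hcard
    _ = 5 * (2 ^ e * 2 ^ m.size) := by ring

end Step

/-! ### The work-list driver, generic in a sound splitting step

A transport of `Shor1997.wstep` / `wrun` and their analysis (`Cryptography/ShorFactoring.lean`)
to an arbitrary splitting step `split : ℕ → ℕ → Option ℕ`; the state `Shor1997.WState`, the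
initial state `winit`, the invariants `Inv1`, `Inv2` and the potential `pot` are reused as they
are. -/

section Driver

variable (split : ℕ → ℕ → Option ℕ)

/-- One round: attempt to split the top of the stack with the block value `X`; on success push
the two factors with fresh budgets `T`, on failure decrement the budget, and after the last
allowed failure declare the number prime ("Recursively call the algorithm on `N/z`").
[cite: FortnowGrochow2011, Prop. 4.10 (proof: recursion on N/z)] -/
def gstep (T : ℕ) (s : WState) (X : ℕ) : WState :=
  match s.todo with
  | [] => s
  | (m, k) :: rest =>
    match split m X with
    | some d => ⟨s.done, (d, T) :: (m / d, T) :: rest⟩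
    | none => if k ≤ 1 then ⟨m :: s.done, rest⟩ else ⟨s.done, (m, k - 1) :: rest⟩

/-- `t` rounds of the driver, round `i` consuming the block value `X i`. [folklore] -/
def grun (T : ℕ) (X : ℕ → ℕ) (s₀ : WState) : ℕ → WState
  | 0 => s₀
  | t + 1 => gstep split T (grun T X s₀ t) (X t)

variable {split}

/-- Zero rounds. [folklore] -/
@[simp] theorem grun_zero (T : ℕ) (X : ℕ → ℕ) (s₀ : WState) : grun split T X s₀ 0 = s₀ := rfl

/-- One more round. [folklore] -/
theorem grun_succ (T : ℕ) (X : ℕ → ℕ) (s₀ : WState) (t : ℕ) :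
    grun split T X s₀ (t + 1) = gstep split T (grun split T X s₀ t) (X t) := rfl

/-- An empty stack idles. [folklore] -/
theorem gstep_nil {T X : ℕ} {s : WState} (h : s.todo = []) : gstep split T s X = s := by
  unfold gstep; split <;> simp_all

/-- The run up to round `t` only depends on the block values before `t`. [folklore] -/
theorem grun_congr {T : ℕ} {X X' : ℕ → ℕ} {s₀ : WState} {t : ℕ} (h : ∀ i < t, X i = X' i) :
    grun split T X s₀ t = grun split T X' s₀ t := by
  induction t with
  | zero => rfl
  | succ t ih =>
    rw [grun_succ, grun_succ, ih fun i hi => h i (by omega), h t (by omega)]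

section Sound

variable (hsound : ∀ ⦃m X d : ℕ⦄, 1 < m → split m X = some d → 1 < d ∧ d < m ∧ d ∣ m)
include hsound

/-- Invariant 1 is preserved by a round: a split replaces `m` by `d, m/d` with `d · (m/d) = m`,
both `> 1` (soundness of the step); the other transitions only move numbers. [folklore] -/
theorem inv1_gstep {n T X : ℕ} {s : WState} (h : Inv1 n s) : Inv1 n (gstep split T s X) := by
  obtain ⟨hprod, hgt⟩ := h
  unfold gstep
  split
  · exact ⟨hprod, hgt⟩
  · rename_i m k rest htodo
    simp only [WState.entries, htodo, List.map_cons, List.prod_append, List.prod_cons,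
      List.mem_append, List.mem_cons, List.mem_map] at hprod hgt
    have hm : 1 < m := hgt m (Or.inr (Or.inl rfl))
    split
    · rename_i d hd
      obtain ⟨hd1, hdm, hdvd⟩ := hsound hm hd
      have hmd : d * (m / d) = m := Nat.mul_div_cancel' hdvd
      have hmd1 : 1 < m / d := by
        by_contra hle; push Not at hle
        have : d * (m / d) ≤ d * 1 := Nat.mul_le_mul_left d hle
        omega
      refine ⟨?_, ?_⟩
      · simp only [WState.entries, List.map_cons, List.prod_append, List.prod_cons, ← hprod,
          ← mul_assoc, hmd]
      · simp only [WState.entries, List.map_cons, List.mem_append, List.mem_cons, List.mem_map]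
        rintro x (hx | rfl | rfl | hx)
        · exact hgt x (Or.inl hx)
        · exact hd1
        · exact hmd1
        · exact hgt x (Or.inr (Or.inr hx))
    · split
      · refine ⟨?_, ?_⟩
        · simp only [WState.entries, List.prod_append, List.prod_cons, ← hprod]; ring
        · simp only [WState.entries, List.mem_append, List.mem_cons, List.mem_map]
          rintro x ((rfl | hx) | hx)
          · exact hm
          · exact hgt x (Or.inl hx)
          · exact hgt x (Or.inr (Or.inr hx))
      · refine ⟨?_, ?_⟩
        · simp only [WState.entries, List.map_cons, List.prod_append, List.prod_cons, ← hprod]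
        · simp only [WState.entries, List.map_cons, List.mem_append, List.mem_cons, List.mem_map]
          rintro x (hx | rfl | hx)
          · exact hgt x (Or.inl hx)
          · exact hm
          · exact hgt x (Or.inr (Or.inr hx))

/-- Invariant 1 along the run. [folklore] -/
theorem inv1_grun {n T : ℕ} {X : ℕ → ℕ} {s₀ : WState} (h : Inv1 n s₀) (t : ℕ) :
    Inv1 n (grun split T X s₀ t) := by
  induction t with
  | zero => exact h
  | succ t ih => exact inv1_gstep hsound ih

/-- **The potential drops every busy round**: a split trades `k + T(2Ω(m) - 2)` for
`2T + T(2Ω(d) - 2) + T(2Ω(m/d) - 2) = T(2Ω(m) - 2)` (additivity of `Ω`), a failure decrements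
`k`, an abandonment removes a whole term. [folklore] -/
theorem pot_gstep {n T X : ℕ} {s : WState} (h1 : Inv1 n s) (h2 : Inv2 T s) (hne : s.todo ≠ []) :
    pot T (gstep split T s X) + 1 ≤ pot T s := by
  unfold gstep
  split
  · rename_i h; exact absurd h hne
  · rename_i m k rest htodo
    have hm : 1 < m := h1.2 m (by simp [WState.entries, htodo])
    have hk : 1 ≤ k := (h2.1 (m, k) (by rw [htodo]; exact List.mem_cons_self)).1
    have hpot : pot T s = k + T * (2 * ArithmeticFunction.cardFactors m - 2) +
        (rest.map fun e => e.2 + T * (2 * ArithmeticFunction.cardFactors e.1 - 2)).sum := by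
      simp [pot, htodo]
    split
    · rename_i d hd
      obtain ⟨hd1, hdm, hdvd⟩ := hsound hm hd
      have hΩ := cardFactors_add_cardFactors_div hm hdvd
      have hΩd := one_le_cardFactors hd1
      have hΩmd : 1 ≤ ArithmeticFunction.cardFactors (m / d) := by
        refine one_le_cardFactors ?_
        by_contra hle; push Not at hle
        have := Nat.mul_div_cancel' hdvd
        have : d * (m / d) ≤ d * 1 := Nat.mul_le_mul_left d hle
        omega
      rw [hpot]
      simp only [pot, List.map_cons, List.sum_cons]
      obtain ⟨a, ha⟩ : ∃ a, ArithmeticFunction.cardFactors d = a + 1 := ⟨_, (Nat.sub_add_cancel hΩd).symm⟩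
      obtain ⟨b, hb⟩ : ∃ b, ArithmeticFunction.cardFactors (m / d) = b + 1 := ⟨_, (Nat.sub_add_cancel hΩmd).symm⟩
      rw [ha, hb, ← hΩ, ha, hb]
      have e1 : 2 * (a + 1) - 2 = 2 * a := by omega
      have e2 : 2 * (b + 1) - 2 = 2 * b := by omega
      have e3 : 2 * (a + 1 + (b + 1)) - 2 = 2 * a + 2 * b + 2 := by omega
      rw [e1, e2, e3]
      nlinarith
    · split
      · rw [hpot]; simp only [pot]; omega
      · rw [hpot]; simp only [pot, List.map_cons, List.sum_cons]; omega

end Sound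

/-- Invariant 2 is preserved by a round (`T ≥ 1`): pushes carry budget `T`, only the top budget
is decremented, and never below `1`. [folklore] -/
theorem inv2_gstep {T X : ℕ} {s : WState} (hT : 1 ≤ T) (h : Inv2 T s) : Inv2 T (gstep split T s X) := by
  obtain ⟨hb, htail⟩ := h
  unfold gstep
  split
  · exact ⟨hb, htail⟩
  · rename_i m k rest htodo
    rw [htodo] at hb htail
    simp only [List.tail_cons, List.mem_cons] at hb htail
    split
    · refine ⟨?_, ?_⟩
      · simp only [List.mem_cons]
        rintro e (rfl | rfl | he)
        · exact ⟨hT, le_rfl⟩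
        · exact ⟨hT, le_rfl⟩
        · exact hb e (Or.inr he)
      · simp only [List.tail_cons, List.mem_cons]
        rintro e (rfl | he)
        · rfl
        · exact htail e he
    · split
      · refine ⟨fun e he => hb e (Or.inr he), fun e he => htail e (List.mem_of_mem_tail he)⟩
      · rename_i hk
        refine ⟨?_, ?_⟩
        · simp only [List.mem_cons]
          rintro e (rfl | he)
          · have := hb (m, k) (Or.inl rfl); simp only at this ⊢; omega
          · exact hb e (Or.inr he)
        · simpa using htail

/-- Invariant 2 along the run. [folklore] -/
theorem inv2_grun {T : ℕ} {X : ℕ → ℕ} {s₀ : WState} (hT : 1 ≤ T) (h : Inv2 T s₀) (t : ℕ) :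
    Inv2 T (grun split T X s₀ t) := by
  induction t with
  | zero => exact h
  | succ t ih => exact inv2_gstep hT ih

section Sound2

variable (hsound : ∀ ⦃m X d : ℕ⦄, 1 < m → split m X = some d → 1 < d ∧ d < m ∧ d ∣ m)
include hsound

/-- After `t` rounds, either the stack is empty or the potential has dropped by `t`. [folklore] -/
theorem pot_grun {n T : ℕ} {X : ℕ → ℕ} {s₀ : WState} (hT : 1 ≤ T) (h1 : Inv1 n s₀)
    (h2 : Inv2 T s₀) (t : ℕ) :
    (grun split T X s₀ t).todo = [] ∨ pot T (grun split T X s₀ t) + t ≤ pot T s₀ := by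
  induction t with
  | zero => exact Or.inr (by simp)
  | succ t ih =>
    by_cases hnil : (grun split T X s₀ t).todo = []
    · left; rw [grun_succ, gstep_nil hnil]; exact hnil
    · right
      rcases ih with h | h
      · exact absurd h hnil
      · have := pot_gstep (X := X t) hsound (inv1_grun hsound h1 t) (inv2_grun hT h2 t) hnil
        rw [grun_succ]; omega

/-- **Termination**: after `pot T s₀` rounds the stack is empty. [folklore] -/
theorem todo_grun_eq_nil {n T : ℕ} {X : ℕ → ℕ} {s₀ : WState} (hT : 1 ≤ T) (h1 : Inv1 n s₀)
    (h2 : Inv2 T s₀) {t : ℕ} (ht : pot T s₀ ≤ t) : (grun split T X s₀ t).todo = [] := by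
  rcases pot_grun (X := X) hsound hT h1 h2 t with h | h
  · exact h
  · by_contra hne
    have := one_le_pot (inv2_grun (X := X) hT h2 t) hne
    omega

end Sound2

/-! ### A wrong answer requires `T` consecutive failures on a composite number -/

section Episodes

variable (split)
variable (T : ℕ) (X : ℕ → ℕ) (s₀ : WState)

/-- An *episode* for `m` starting at round `j`: `m` sits on top of the stack with its full
budget `T` before round `j`, and the attempts of rounds `j, …, j + T - 1` on `m` all fail.
[folklore] -/
def GEpisode (m j : ℕ) : Prop :=
  (grun split T X s₀ j).todo.head? = some (m, T) ∧ ∀ i < T, split m (X (j + i)) = none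

/-- Invariant 3 (history): the top entry `(m, k)` has been on top since round `t - (T - k)`,
failing ever since; every finished number went through a full episode. [folklore] -/
def GInv3 (t : ℕ) : Prop :=
  (∀ m k rest, (grun split T X s₀ t).todo = (m, k) :: rest →
      T - k ≤ t ∧ (grun split T X s₀ (t - (T - k))).todo.head? = some (m, T) ∧
        ∀ i < T - k, split m (X (t - (T - k) + i)) = none) ∧
  ∀ m ∈ (grun split T X s₀ t).done, ∃ j, j + T ≤ t ∧ GEpisode split T X s₀ m j

variable {split T X s₀}

/-- Invariant 3 holds initially. [folklore] -/
theorem ginv3_zero {n : ℕ} (h : s₀ = winit n T) : GInv3 split T X s₀ 0 := by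
  subst h
  refine ⟨fun m k rest heq => ?_, fun m hm => ?_⟩
  · simp only [grun_zero, winit, List.cons.injEq, Prod.mk.injEq] at heq
    obtain ⟨⟨rfl, rfl⟩, -⟩ := heq
    simp [winit]
  · simp [winit] at hm

/-- Invariant 3 is preserved by a round: a split puts a fresh entry on top (empty history); a
failure extends the history of the top entry by the current round; an abandonment closes the
history of the top entry into a full episode and exposes the next entry, whose budget is `T`
(Invariant 2). [folklore] -/
theorem ginv3_succ (hT : 1 ≤ T) (h2 : Inv2 T s₀) {t : ℕ} (h : GInv3 split T X s₀ t) :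
    GInv3 split T X s₀ (t + 1) := by
  obtain ⟨htop, hdone⟩ := h
  have hI2 := inv2_grun (split := split) (X := X) hT h2 t
  rcases htodo : (grun split T X s₀ t).todo with _ | ⟨⟨m, k⟩, rest⟩
  · -- idle round
    have hs : grun split T X s₀ (t + 1) = grun split T X s₀ t := by rw [grun_succ, gstep_nil htodo]
    rw [GInv3, hs, htodo]
    exact ⟨fun m k rest heq => by simp at heq, fun m hm => by
      obtain ⟨j, hj, he⟩ := hdone m hm; exact ⟨j, by omega, he⟩⟩
  · obtain ⟨hle, hhead, hfail⟩ := htop m k rest htodo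
    have hk := hI2.1 (m, k) (by rw [htodo]; exact List.mem_cons_self)
    simp only at hk
    rcases hsplit : split m (X t) with _ | d
    · by_cases hk1 : k ≤ 1
      · -- abandon `m`
        have hk1' : k = 1 := by omega
        subst hk1'
        have hs : grun split T X s₀ (t + 1) = ⟨m :: (grun split T X s₀ t).done, rest⟩ := by
          rw [grun_succ]; unfold gstep; simp only [htodo, hsplit]; simp
        rw [GInv3, hs]
        refine ⟨fun m' k' rest' heq => ?_, fun m' hm' => ?_⟩
        · simp only at heq
          subst heq
          have hk' : k' = T := hI2.2 (m', k') (by rw [htodo]; simp)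
          subst hk'
          refine ⟨by omega, ?_, fun i hi => by omega⟩
          simp only [Nat.sub_self, Nat.sub_zero, hs, List.head?_cons]
        · simp only [List.mem_cons] at hm'
          rcases hm' with rfl | hm'
          · refine ⟨t - (T - 1), by omega, hhead, fun i hi => ?_⟩
            rcases Nat.lt_or_ge i (T - 1) with hi' | hi'
            · exact hfail i hi'
            · have : t - (T - 1) + i = t := by omega
              rw [this]; exact hsplit
          · obtain ⟨j, hj, he⟩ := hdone m' hm'
            exact ⟨j, by omega, he⟩
      · -- decrement the budget of `m`
        have hs : grun split T X s₀ (t + 1) = ⟨(grun split T X s₀ t).done, (m, k - 1) :: rest⟩ := by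
          rw [grun_succ]; unfold gstep; simp only [htodo, hsplit]; simp [hk1]
        rw [GInv3, hs]
        refine ⟨fun m' k' rest' heq => ?_, fun m' hm' => ?_⟩
        · simp only [List.cons.injEq, Prod.mk.injEq] at heq
          obtain ⟨⟨rfl, rfl⟩, rfl⟩ := heq
          have e1 : T - (k - 1) = T - k + 1 := by omega
          have e2 : t + 1 - (T - k + 1) = t - (T - k) := by omega
          rw [e1, e2]
          refine ⟨by omega, hhead, fun i hi => ?_⟩
          rcases Nat.lt_or_ge i (T - k) with hi' | hi'
          · exact hfail i hi'
          · have : t - (T - k) + i = t := by omega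
            rw [this]; exact hsplit
        · obtain ⟨j, hj, he⟩ := hdone m' hm'
          exact ⟨j, by omega, he⟩
    · -- split `m = d * (m / d)`
      have hs : grun split T X s₀ (t + 1) = ⟨(grun split T X s₀ t).done, (d, T) :: (m / d, T) :: rest⟩ := by
        rw [grun_succ]; unfold gstep; simp only [htodo, hsplit]
      rw [GInv3, hs]
      refine ⟨fun m' k' rest' heq => ?_, fun m' hm' => ?_⟩
      · simp only [List.cons.injEq, Prod.mk.injEq] at heq
        obtain ⟨⟨rfl, rfl⟩, -⟩ := heq
        refine ⟨by omega, ?_, fun i hi => by omega⟩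
        simp only [Nat.sub_self, Nat.sub_zero, hs, List.head?_cons]
      · obtain ⟨j, hj, he⟩ := hdone m' hm'
        exact ⟨j, by omega, he⟩

/-- Invariant 3 along the run from `winit n T`. [folklore] -/
theorem ginv3_grun {n : ℕ} (hT : 1 ≤ T) (h : s₀ = winit n T) (t : ℕ) : GInv3 split T X s₀ t := by
  have h2 : Inv2 T s₀ := h ▸ inv2_winit n hT
  induction t with
  | zero => exact ginv3_zero h
  | succ t ih => exact ginv3_succ hT h2 ih

end Episodes

/-- **The dichotomy.** With a sound step, budget `T ≥ 1` per number and at least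
`pot T (winit n T)` rounds, either the sorted list of finished numbers *is* the prime
factorisation of `n`, or some composite divisor `m > 1` of `n` went through a full episode of `T`
failed attempts. [folklore] -/
theorem grun_dichotomy (hsound : ∀ ⦃m X d : ℕ⦄, 1 < m → split m X = some d → 1 < d ∧ d < m ∧ d ∣ m)
    {n T R : ℕ} {X : ℕ → ℕ} (hn : 1 < n) (hT : 1 ≤ T) (hR : pot T (winit n T) ≤ R) :
    ((grun split T X (winit n T) R).done.insertionSort (· ≤ ·) = n.primeFactorsList) ∨
      ∃ j m, j + T ≤ R ∧ 1 < m ∧ m ∣ n ∧ ¬ m.Prime ∧ GEpisode split T X (winit n T) m j := by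
  have h1 := inv1_grun (split := split) (X := X) (T := T) hsound (inv1_winit hn T) R
  have hnil := todo_grun_eq_nil (split := split) (X := X) hsound hT (inv1_winit hn T) (inv2_winit n hT) hR
  have hentries : (grun split T X (winit n T) R).entries = (grun split T X (winit n T) R).done := by
    simp [WState.entries, hnil]
  by_cases hall : ∀ m ∈ (grun split T X (winit n T) R).done, m.Prime
  · left
    have hprod : (grun split T X (winit n T) R).done.prod = n := hentries ▸ h1.1
    have hperm := Nat.primeFactorsList_unique hprod hall
    exact ((List.perm_insertionSort _ _).trans hperm).eq_of_sortedLE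
      (List.sortedLE_insertionSort) (Nat.primeFactorsList_sorted n)
  · right
    push Not at hall
    obtain ⟨m, hm, hmp⟩ := hall
    obtain ⟨j, hj, he⟩ := (ginv3_grun (split := split) (X := X) hT rfl R).2 m hm
    have hme : m ∈ (grun split T X (winit n T) R).entries := hentries ▸ hm
    exact ⟨j, m, hj, h1.2 m hme, Shor1997.Inv1.dvd_of_mem h1 hme, hmp, he⟩

/-! ### The failure probability of the driver -/

section Fail

open Finset

variable (split)

/-- The target sets of the cylinder bound: for a top entry `(m, ·)` with `m` composite of size
`≤ B`, the blocks whose value fails to split `m`; empty otherwise. [folklore] -/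
def gfailBlocks (B : ℕ) : Option (ℕ × ℕ) → Finset (Fin B → Bool)
  | none => ∅
  | some e => if 1 < e.1 ∧ ¬ e.1.Prime ∧ e.1.size ≤ B then
      univ.filter fun a => split e.1 (Cryptography.blockVal a) = none else ∅

variable {split}
variable (hfail : ∀ ⦃m B : ℕ⦄, 1 < m → ¬ m.Prime → m.size ≤ B →
    6 * ((Finset.range (2 ^ B)).filter fun X => split m X = none).card ≤ 5 * 2 ^ B)
include hfail

/-- Every target set has density `≤ 5/6`. [folklore] -/
theorem six_mul_card_gfailBlocks_le (B : ℕ) (b : Option (ℕ × ℕ)) :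
    6 * (gfailBlocks split B b).card ≤ 5 * Fintype.card (Fin B → Bool) := by
  rcases b with _ | ⟨m, k⟩
  · simp [gfailBlocks]
  · simp only [gfailBlocks]
    split_ifs with h
    · rw [card_filter_blockVal B (fun x => split m x = none), Shor1997.card_blocks]
      exact hfail h.1 h.2.1 h.2.2
    · simp

variable (hsound : ∀ ⦃m X d : ℕ⦄, 1 < m → split m X = some d → 1 < d ∧ d < m ∧ d ∣ m)
include hsound

/-- **Failure count of the driver.** Over samples of `R` independent uniform blocks of `B ≥ size n`
bits, with budget `T ≥ 1` and `R ≥ pot T (winit n T)` rounds, the samples on which the sorted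
output is not the prime factorisation of `n` number at most `R · (5/6)^T · (2^B)^R`.
[cite: FortnowGrochow2011, Prop. 4.10 (proof: repetition of the reduction)] -/
theorem card_gfail_le {n T R B : ℕ} (hn : 1 < n) (hT : 1 ≤ T) (hR : pot T (winit n T) ≤ R)
    (hB : n.size ≤ B) :
    6 ^ T * (univ.filter fun ω : Fin R → Fin B → Bool =>
        (grun split T (Xof ω) (winit n T) R).done.insertionSort (· ≤ ·) ≠ n.primeFactorsList).card ≤
      R * (5 ^ T * Fintype.card (Fin B → Bool) ^ R) := by
  classical
  have hR0 : 0 < R := by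
    have : T ≤ pot T (winit n T) := by rw [pot_winit]; omega
    omega
  -- coordinates and labels of the cylinder bound
  let co : ℕ → Fin R := fun t => ⟨t % R, Nat.mod_lt _ hR0⟩
  let g : ℕ → (Fin R → Fin B → Bool) → Option (ℕ × ℕ) := fun j ω =>
    (grun split T (Xof ω) (winit n T) j).todo.head?
  let E : ℕ → Finset (Fin R → Fin B → Bool) := fun j =>
    univ.filter fun ω => ∀ i < T, ω (co (j + i)) ∈ gfailBlocks split B (g j ω)
  have hco : ∀ {t : ℕ} (ht : t < R), co t = ⟨t, ht⟩ := by
    intro t ht; simp [co, Nat.mod_eq_of_lt ht]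
  -- the failure event is covered by the cylinders `E j`, `j + T ≤ R`
  have hcover : (univ.filter fun ω : Fin R → Fin B → Bool =>
      (grun split T (Xof ω) (winit n T) R).done.insertionSort (· ≤ ·) ≠ n.primeFactorsList) ⊆
      ((range R).filter fun j => j + T ≤ R).biUnion E := by
    intro ω hω
    simp only [mem_filter, mem_univ, true_and] at hω
    rcases grun_dichotomy (split := split) (X := Xof ω) hsound hn hT hR with h | ⟨j, m, hjT, hm1, hmn, hmp, hhead, hfl⟩
    · exact absurd h hω
    · simp only [mem_biUnion, mem_filter, mem_range]
      refine ⟨j, ⟨by omega, hjT⟩, ?_⟩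
      simp only [E, mem_filter, mem_univ, true_and]
      intro i hi
      have hsize : m.size ≤ B := (Nat.size_le_size (Nat.le_of_dvd (by omega) hmn)).trans hB
      simp only [g, hhead, gfailBlocks, hm1, hmp, hsize, not_false_eq_true, and_self, if_true,
        mem_filter, mem_univ, true_and]
      have := hfl i hi
      simp only [Xof, dif_pos (show j + i < R by omega)] at this
      rw [hco (show j + i < R by omega)]
      exact this
  -- each cylinder is small
  have hE : ∀ j, j + T ≤ R → 6 ^ T * (E j).card ≤ 5 ^ T * Fintype.card (Fin B → Bool) ^ R := by
    intro j hjT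
    have h := card_cylinder_le (ι := Fin R) (α := Fin B → Bool) co j T ?_ (g j) ?_
      (gfailBlocks split B) 6 5 (six_mul_card_gfailBlocks_le hfail B)
    · simpa [Fintype.card_fin] using h
    · intro i i' hi hi' heq
      rw [hco (show j + i < R by omega), hco (show j + i' < R by omega)] at heq
      simp only [Fin.mk.injEq] at heq
      omega
    · intro ω i a hi
      simp only [g]
      rw [grun_congr (X' := Xof ω)]
      intro t ht
      simp only [Xof]
      split_ifs with htR
      · rw [Function.update_of_ne]
        rw [hco (show j + i < R by omega)]
        intro heq
        simp only [Fin.mk.injEq] at heq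
        omega
      · rfl
  calc 6 ^ T * _ ≤ 6 ^ T * (((range R).filter fun j => j + T ≤ R).biUnion E).card :=
        Nat.mul_le_mul_left _ (card_le_card hcover)
    _ ≤ 6 ^ T * ∑ j ∈ (range R).filter (fun j => j + T ≤ R), (E j).card :=
        Nat.mul_le_mul_left _ card_biUnion_le
    _ = ∑ j ∈ (range R).filter (fun j => j + T ≤ R), 6 ^ T * (E j).card := by rw [mul_sum]
    _ ≤ ∑ j ∈ (range R).filter (fun j => j + T ≤ R), 5 ^ T * Fintype.card (Fin B → Bool) ^ R :=
        sum_le_sum fun j hj => hE j (mem_filter.1 hj).2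
    _ = ((range R).filter fun j => j + T ≤ R).card * (5 ^ T * Fintype.card (Fin B → Bool) ^ R) := by
        rw [sum_const, smul_eq_mul]
    _ ≤ R * (5 ^ T * Fintype.card (Fin B → Bool) ^ R) := by
        refine Nat.mul_le_mul_right _ ?_
        exact (card_filter_le _ _).trans (card_range R).le

/-- **Failure probability of the driver** (real form): with coin strings of length `R · B`,
`P[sorted output ≠ primeFactorsList n] ≤ R · (5/6)^T`. [cite: FortnowGrochow2011, Prop. 4.10 (proof)] -/
theorem uniformProb_gfail_le {n T R B : ℕ} (hn : 1 < n) (hT : 1 ≤ T) (hR : pot T (winit n T) ≤ R)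
    (hB : n.size ≤ B) :
    uniformProb (R * B) {c | (grun split T (Xof (coinBlocks R B c)) (winit n T) R).done.insertionSort
        (· ≤ ·) ≠ n.primeFactorsList} ≤ R * (5 / 6 : ℝ) ^ T := by
  classical
  rw [Literature.Computability.QuantumComplexity.uniformProb_eq_card_ofFn]
  have hcount := card_gfail_le hfail hsound hn hT hR hB (R := R) (B := B)
  rw [Shor1997.card_blocks] at hcount
  have h6 : (0 : ℝ) < 6 ^ T := by positivity
  have h2 : (0 : ℝ) < 2 ^ (R * B) := by positivity
  have hpow : ((2 : ℝ) ^ B) ^ R = 2 ^ (R * B) := by rw [← pow_mul, mul_comm]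
  calc _ = ((univ.filter fun ω : Fin R → Fin B → Bool =>
        (grun split T (Xof ω) (winit n T) R).done.insertionSort (· ≤ ·) ≠ n.primeFactorsList).card : ℝ) /
          2 ^ (R * B) := by
        congr 2
        refine card_equiv (coinEquiv R B) fun y => ?_
        simp only [mem_filter, mem_univ, true_and, Set.mem_setOf_eq, coinBlocks_ofFn]
    _ ≤ R * (5 / 6 : ℝ) ^ T := by
        rw [div_le_iff₀ h2, div_pow,
          show (R : ℝ) * (5 ^ T / 6 ^ T) * 2 ^ (R * B) = R * (5 ^ T * 2 ^ (R * B)) / 6 ^ T by ring,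
          le_div_iff₀ h6]
        calc (_ : ℝ) * 6 ^ T = 6 ^ T * _ := mul_comm _ _
          _ ≤ R * (5 ^ T * (2 ^ B) ^ R) := by exact_mod_cast hcount
          _ = R * (5 ^ T * 2 ^ (R * B)) := by rw [hpow]

end Fail

end Driver

/-! ### The Rabin driver and its success probability -/

section RabinDriver

variable (Y : ℕ → ℕ → ℕ)

/-- The splitting step of the Rabin driver for a family of square-root tables `Y m`. [folklore] -/
def rabinStep (m X : ℕ) : Option ℕ := rabinSplit (Y m) m X

/-- **The recursive factoring algorithm of the printed proof** on the number `n`: trivial for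
`n ≤ 1`, otherwise `R` rounds of the work-list driver with the Rabin step and budget `T`, output
sorted. [cite: FortnowGrochow2011, Prop. 4.10 (proof: "Recursively call the algorithm on N/z")] -/
def rabinDriver (n T R : ℕ) (X : ℕ → ℕ) : List ℕ :=
  if n ≤ 1 then [] else ((grun (rabinStep Y) T X (winit n T) R).done).insertionSort (· ≤ ·)

variable {Y}

/-- The Rabin step is sound. [cite: FortnowGrochow2011, Prop. 4.10 (proof)] -/
theorem rabinStep_sound : ∀ ⦃m X d : ℕ⦄, 1 < m → rabinStep Y m X = some d → 1 < d ∧ d < m ∧ d ∣ m :=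
  fun _ _ _ hm h => rabinSplit_sound hm h

/-- **Success probability of the Rabin driver**: for a family of square-root tables (`(Y m x)² ≡ x²`
and `Y m x` a function of `x² mod m` — the content of a canonical form for the Rabin kernel), for
every `n < 2^{L+1}`, with `64 (L+1)³` uniform coins read as `64 (L+1)²` blocks of `L + 1` bits and
budget `32 (L+1)`, the driver outputs the prime factorisation of `n` with probability `≥ 3/4`.
[cite: FortnowGrochow2011, Prop. 4.10 (proof)] -/
theorem rabinDriver_success (hY₁ : ∀ m x, (Y m x) ^ 2 % m = x ^ 2 % m)
    (hY₂ : ∀ m x x', x ^ 2 % m = x' ^ 2 % m → Y m x = Y m x') (L : ℕ) {n : ℕ} (hnL : n < 2 ^ (L + 1)) :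
    3 / 4 ≤ uniformProb (coinLen L)
      {c | rabinDriver Y n (budget L) (rounds L) (Xof (coinBlocks (rounds L) (blockLen L) c)) =
        n.primeFactorsList} := by
  by_cases hn1 : n ≤ 1
  · have : {c | rabinDriver Y n (budget L) (rounds L) (Xof (coinBlocks (rounds L) (blockLen L) c)) =
        n.primeFactorsList} = Set.univ := by
      refine Set.eq_univ_of_forall fun c => ?_
      simp only [Set.mem_setOf_eq, rabinDriver, hn1, if_true]
      rcases Nat.le_one_iff_eq_zero_or_eq_one.1 hn1 with h | h <;> simp [h]
    rw [this, uniformProb_univ]; norm_num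
  push Not at hn1
  have hsize : n.size ≤ blockLen L := Nat.size_le.2 hnL
  have hT : 1 ≤ budget L := by simp only [budget]; omega
  have hfail : ∀ ⦃m B : ℕ⦄, 1 < m → ¬ m.Prime → m.size ≤ B →
      6 * ((Finset.range (2 ^ B)).filter fun X => rabinStep Y m X = none).card ≤ 5 * 2 ^ B :=
    fun m B hm hp hB => rabinSplit_fail_card hm hp hB (hY₁ m) (hY₂ m)
  have hf := uniformProb_gfail_le (R := rounds L) hfail rabinStep_sound hn1 hT (pot_winit_le_rounds hn1 hnL) hsize
  have hnum := rounds_mul_pow_le L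
  set F : Set (List Bool) := {c | (grun (rabinStep Y) (budget L) (Xof (coinBlocks (rounds L)
      (blockLen L) c)) (winit n (budget L)) (rounds L)).done.insertionSort (· ≤ ·) ≠ n.primeFactorsList} with hF
  have hsub : Fᶜ ⊆ {c | rabinDriver Y n (budget L) (rounds L) (Xof (coinBlocks (rounds L) (blockLen L) c)) =
        n.primeFactorsList} := by
    intro c hc
    simp only [hF, Set.mem_compl_iff, Set.mem_setOf_eq, not_not] at hc
    simp only [Set.mem_setOf_eq, rabinDriver, show ¬ n ≤ 1 by omega, if_false, hc]
  have hcompl := Literature.Computability.QuantumComplexity.uniformProb_compl (coinLen L) F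
  have hmono := Cryptography.uniformProb_mono (coinLen L) hsub
  change uniformProb (coinLen L) F ≤ _ at hf
  linarith

end RabinDriver

end FGRabin

/-! ### The driver as a polynomial-time string function

The round function is written in the brick algebra on the seven-field records
`⟨x, ⟨coins, ⟨answers, ⟨todoN, ⟨todoB, ⟨done, status⟩⟩⟩⟩⟩⟩` of `Cryptography/ShorRoundFP.lean`
(`ShorFP.rec7`, `ShorFP.recOf`), with the answers and status fields kept empty, reusing its
field projections, outcome records (`splitR`, `failR`, `idleR`) and growth lemmas; only the
last branch — the Rabin divisor `gcd(x + y, m)` with `y` read off the canonical form — is new. -/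

namespace FGRabinFP

open Polynomial Brick
open Literature.Computability.Cryptography.ShorFP

variable (cf : List Bool → List Bool)

/-- **The square-root table of a canonical form** `cf` for the Rabin kernel: the number decoded
from the second component of `cf ⟨m, x⟩`. [cite: FortnowGrochow2011, Prop. 4.10 (proof: "let y = f(x)")] -/
def Ytab (m x : ℕ) : ℕ := decodeNat (boolUnpair (cf (boolPair (encodeNat m) (encodeNat x)))).2

/-! #### The new bricks of the round -/

/-- The square root `y = Y m x` as a canonical numeral. [folklore] -/
def yRabF : List Bool → List Bool := ShorFP.canonF ∘ sndF ∘ cf ∘ pr mF xlF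
/-- The Rabin divisor `gcd(x + y, m)`. [cite: FortnowGrochow2011, Prop. 4.10 (proof)] -/
def dRabF : List Bool → List Bool := gcdFn ∘ pr (addFn ∘ pr xlF (yRabF cf)) mF
/-- The test `1 < gcd(x + y, m) < m`. [folklore] -/
def cRab : List Bool → List Bool := andFn (valGeTwoFn ∘ dRabF cf) (ltFn ∘ pr (dRabF cf) mF)

/-- **One round of the Rabin driver**: the case distinction of `FGRabin.rabinSplit` / `gstep`.
[cite: FortnowGrochow2011, Prop. 4.10 (proof)] -/
def roundG : List Bool → List Bool :=
  iteFn cIdle idleR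
    (iteFn cEven (iteFn cTwo (failR asF) (splitR twoF asF))
      (iteFn cPP (splitR (sndF ∘ ppDF) asF)
        (iteFn cBad (failR asF)
          (iteFn cG (splitR gF asF)
            (iteFn (cRab cf) (splitR (dRabF cf) asF) (failR asF))))))

variable {cf}

/-- `yRabF cf ∈ FP` for `cf ∈ FP`. [folklore] -/
theorem yRabF_mem_FP (hcf : cf ∈ FP) : yRabF cf ∈ FP :=
  comp_mem_FP ShorFP.canonF_mem_FP (comp_mem_FP sndF_mem_FP (comp_mem_FP hcf (fanoutFn_mem_FP mF_mem_FP xlF_mem_FP)))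
/-- `dRabF cf ∈ FP`. [folklore] -/
theorem dRabF_mem_FP (hcf : cf ∈ FP) : dRabF cf ∈ FP :=
  comp_mem_FP gcdFn_mem_FP (fanoutFn_mem_FP (comp_mem_FP addFn_mem_FP (fanoutFn_mem_FP xlF_mem_FP (yRabF_mem_FP hcf))) mF_mem_FP)
/-- `cRab cf ∈ FP`. [folklore] -/
theorem cRab_mem_FP (hcf : cf ∈ FP) : cRab cf ∈ FP :=
  andFn_mem_FP (comp_mem_FP valGeTwoFn_mem_FP (dRabF_mem_FP hcf))
    (comp_mem_FP ltFn_mem_FP (fanoutFn_mem_FP (dRabF_mem_FP hcf) mF_mem_FP))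

/-- **`roundG cf ∈ FP`** for `cf ∈ FP`. [cite: AroraBarak2009, §1.3 (closure of polynomial time under composition)] -/
theorem roundG_mem_FP (hcf : cf ∈ FP) : roundG cf ∈ FP :=
  iteFn_mem_FP cIdle_mem_FP idleR_mem_FP
    (iteFn_mem_FP cEven_mem_FP (iteFn_mem_FP cTwo_mem_FP (failR_mem_FP (nthF_mem_FP 2)) (splitR_mem_FP twoF_mem_FP (nthF_mem_FP 2)))
      (iteFn_mem_FP cPP_mem_FP (splitR_mem_FP (comp_mem_FP sndF_mem_FP ppDF_mem_FP) (nthF_mem_FP 2))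
        (iteFn_mem_FP cBad_mem_FP (failR_mem_FP (nthF_mem_FP 2))
          (iteFn_mem_FP cG_mem_FP (splitR_mem_FP gF_mem_FP (nthF_mem_FP 2))
            (iteFn_mem_FP (cRab_mem_FP hcf) (splitR_mem_FP (dRabF_mem_FP hcf) (nthF_mem_FP 2)) (failR_mem_FP (nthF_mem_FP 2)))))))

/-- `cRab cf` is one-bit. [folklore] -/
theorem oneBit_cRab : OneBit (cRab cf) := oneBit_andFn (oneBit_valGeTwoFn.comp _) (oneBit_ltFn.comp _)

/-! #### Evaluation on a configuration -/

section Eval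

variable (x : List Bool) (c : List Bool) (m k : ℕ) (rest : List (ℕ × ℕ)) (done : List ℕ)

/-- The square root read off the canonical form. [folklore] -/
theorem yRabF_recOf : yRabF cf (recOf x c [] ((m, k) :: rest) done []) = encodeNat (Ytab cf m (ShorFP.blockVal x c % 2 ^ m.size)) := by
  simp only [yRabF, Function.comp_apply, fanoutFn_apply, mF_recOf, xlF_recOf, ShorFP.canonF_apply, Ytab,
    encodeNat_decodeNat_eq_canonBits]
  rfl

/-- The Rabin divisor. [folklore] -/
theorem dRabF_recOf : dRabF cf (recOf x c [] ((m, k) :: rest) done []) =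
    encodeNat (Nat.gcd (ShorFP.blockVal x c % 2 ^ m.size + Ytab cf m (ShorFP.blockVal x c % 2 ^ m.size)) m) := by
  simp only [dRabF, Function.comp_apply, fanoutFn_apply, xlF_recOf, yRabF_recOf, mF_recOf, addFn_boolPair,
    gcdFn_boolPair, bitsToNat_encodeNat]

/-- The Rabin test. [folklore] -/
theorem cRab_recOf : cRab cf (recOf x c [] ((m, k) :: rest) done []) =
    [decide (1 < Nat.gcd (ShorFP.blockVal x c % 2 ^ m.size + Ytab cf m (ShorFP.blockVal x c % 2 ^ m.size)) m ∧
      Nat.gcd (ShorFP.blockVal x c % 2 ^ m.size + Ytab cf m (ShorFP.blockVal x c % 2 ^ m.size)) m < m)] := by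
  have h1 : (valGeTwoFn ∘ dRabF cf) (recOf x c [] ((m, k) :: rest) done []) =
      [decide (1 < Nat.gcd (ShorFP.blockVal x c % 2 ^ m.size + Ytab cf m (ShorFP.blockVal x c % 2 ^ m.size)) m)] := by
    simp [valGeTwoFn, dRabF_recOf]; omega
  have h2 : (ltFn ∘ pr (dRabF cf) mF) (recOf x c [] ((m, k) :: rest) done []) =
      [decide (Nat.gcd (ShorFP.blockVal x c % 2 ^ m.size + Ytab cf m (ShorFP.blockVal x c % 2 ^ m.size)) m < m)] := by
    simp [dRabF_recOf]
  rw [cRab, andFn_apply h1 h2, Bool.decide_and]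

/-- **The round realises one splitting attempt** (`FGRabin.rabinSplit`) on the record of a
configuration whose top number satisfies `2 ≤ m`, with the block value read off the next
`|x| + 1` coins. [cite: FortnowGrochow2011, Prop. 4.10 (proof)] -/
theorem roundG_recOf (hm : 2 ≤ m) :
    roundG cf (recOf x c [] ((m, k) :: rest) done []) = afterR x c [] done m k rest
      (Sum.inr (FGRabin.rabinSplit (Ytab cf m) m (ShorFP.blockVal x c), [])) := by
  have hidle : cIdle (recOf x c [] ((m, k) :: rest) done []) = [false] := by rw [cIdle_recOf]; simp
  rw [roundG, iteFn_apply_false hidle]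
  set X := ShorFP.blockVal x c with hX
  set xl := X % 2 ^ m.size with hxl
  by_cases he : Even m
  · -- even
    rw [iteFn_apply_true (by rw [cEven_recOf]; simp [he])]
    have hs : FGRabin.rabinSplit (Ytab cf m) m X = (if m = 2 then none else some 2) := by
      simp [FGRabin.rabinSplit, he]
    rw [hs]
    by_cases h2 : m = 2
    · rw [iteFn_apply_true (by rw [cTwo_recOf]; simp [h2]), if_pos h2]
      exact failR_eq_afterR x c [] done m k rest (by simp)
    · rw [iteFn_apply_false (by rw [cTwo_recOf]; simp [h2]), if_neg h2]
      exact splitR_eq_afterR x c [] done m k rest (by simp [twoF]; rfl) (by simp)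
  rw [iteFn_apply_false (by rw [cEven_recOf]; simp [he])]
  by_cases hpp : ppBase m < m
  · -- perfect power
    rw [iteFn_apply_true (by rw [cPP_recOf x c [] m k rest done [] hm]; simp [hpp])]
    have hs : FGRabin.rabinSplit (Ytab cf m) m X = some (ppBase m) := by simp [FGRabin.rabinSplit, he, hpp]
    rw [hs]
    exact splitR_eq_afterR x c [] done m k rest (by simp [ppDF_recOf x c [] m k rest done [] hm, hpp]) (by simp)
  rw [iteFn_apply_false (by rw [cPP_recOf x c [] m k rest done [] hm]; simp [hpp])]
  by_cases hbad : xl = 0 ∨ m ≤ xl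
  · -- failed draw
    rw [iteFn_apply_true (by rw [cBad_recOf]; simp only [← hX, ← hxl]; simp [hbad])]
    have hs : FGRabin.rabinSplit (Ytab cf m) m X = none := by
      simp only [FGRabin.rabinSplit, if_neg he, if_neg hpp, ← hxl]
      rw [if_pos hbad]
    rw [hs]
    exact failR_eq_afterR x c [] done m k rest (by simp)
  rw [iteFn_apply_false (by rw [cBad_recOf]; simp only [← hX, ← hxl]; simp [hbad])]
  by_cases hg : 1 < Nat.gcd xl m
  · -- non-unit: the gcd
    rw [iteFn_apply_true (by rw [cG_recOf]; simp only [← hX, ← hxl]; simp [hg])]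
    have hs : FGRabin.rabinSplit (Ytab cf m) m X = some (Nat.gcd xl m) := by
      simp only [FGRabin.rabinSplit, if_neg he, if_neg hpp, ← hxl]
      rw [if_neg hbad, if_pos hg]
    rw [hs]
    exact splitR_eq_afterR x c [] done m k rest (by rw [gF_recOf]) (by simp)
  rw [iteFn_apply_false (by rw [cG_recOf]; simp only [← hX, ← hxl]; simp [hg])]
  -- the Rabin divisor
  set g := Nat.gcd (xl + Ytab cf m xl) m with hgdef
  have hcr : cRab cf (recOf x c [] ((m, k) :: rest) done []) = [decide (1 < g ∧ g < m)] := by rw [cRab_recOf]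
  by_cases hrab : 1 < g ∧ g < m
  · rw [iteFn_apply_true (by rw [hcr]; simp [hrab])]
    have hs : FGRabin.rabinSplit (Ytab cf m) m X = some g := by
      simp only [FGRabin.rabinSplit, if_neg he, if_neg hpp, ← hxl]
      rw [if_neg hbad, if_neg hg]
      simp only [← hgdef]
      rw [if_pos hrab]
    rw [hs]
    exact splitR_eq_afterR x c [] done m k rest (by rw [dRabF_recOf]) (by simp)
  · rw [iteFn_apply_false (by rw [hcr]; simp [hrab])]
    have hs : FGRabin.rabinSplit (Ytab cf m) m X = none := by
      simp only [FGRabin.rabinSplit, if_neg he, if_neg hpp, ← hxl]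
      rw [if_neg hbad, if_neg hg]
      simp only [← hgdef]
      rw [if_neg hrab]
    rw [hs]
    exact failR_eq_afterR x c [] done m k rest (by simp)

/-- **The round realises `FGRabin.gstep`** on a configuration with top number `≥ 2`. [folklore] -/
theorem roundG_recOf_gstep (hm : 2 ≤ m) :
    roundG cf (recOf x c [] ((m, k) :: rest) done []) =
      recOf x (c.drop (x.length + 1)) []
        (FGRabin.gstep (FGRabin.rabinStep (Ytab cf)) (budget x.length) ⟨done, (m, k) :: rest⟩ (ShorFP.blockVal x c)).todo
        (FGRabin.gstep (FGRabin.rabinStep (Ytab cf)) (budget x.length) ⟨done, (m, k) :: rest⟩ (ShorFP.blockVal x c)).done [] := by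
  rw [roundG_recOf x c m k rest done hm]
  simp only [FGRabin.gstep, FGRabin.rabinStep]
  rcases FGRabin.rabinSplit (Ytab cf m) m (ShorFP.blockVal x c) with _ | d
  · rw [afterR]
    by_cases hk : k ≤ 1
    · simp [hk]
    · simp [hk]
  · rfl

/-- **An idle round** (empty work list): the coins move. [folklore] -/
theorem roundG_recOf_idle : roundG cf (recOf x c [] [] done []) = recOf x (c.drop (x.length + 1)) [] [] done [] := by
  rw [roundG, iteFn_apply_true (by rw [cIdle_recOf]; simp), idleR_recOf]

end Eval

/-! #### The first field is kept; the growth of one round -/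

section Growth

/-- **`roundG` keeps the first field** (the instance `x`), on every string. [folklore] -/
theorem fstF_roundG (z : List Bool) : fstF (roundG cf z) = fstF z := by
  have hsplit : ∀ d A, KeepsFst (splitR d A) := fun d A => keepsFst_mk7 _ _ _ _ _ _
  have hfail : ∀ A, KeepsFst (failR A) := fun A => KeepsFst.ite oneBit_cLast (keepsFst_mk7 _ _ _ _ _ _) (keepsFst_mk7 _ _ _ _ _ _)
  have h : KeepsFst (roundG cf) :=
    KeepsFst.ite oneBit_cIdle (keepsFst_mk7 _ _ _ _ _ _)
      (KeepsFst.ite oneBit_cEven (KeepsFst.ite oneBit_cTwo (hfail _) (hsplit _ _))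
        (KeepsFst.ite oneBit_cPP (hsplit _ _)
          (KeepsFst.ite oneBit_cBad (hfail _)
            (KeepsFst.ite oneBit_cG (hsplit _ _)
              (KeepsFst.ite oneBit_cRab (hsplit _ _) (hfail _))))))
  exact h z

/-- Past the draw test the top numeral has a positive value. [folklore] -/
theorem bitsToNat_mF_pos_of_cBad {z : List Bool} (h : cBad z = [false]) : 0 < bitsToNat (mF z) := by
  by_cases h0 : xlF z = []
  · rw [cBad, iteFn_apply_true (by simp [isNilFn, h0])] at h
    simp at h
  · have h1 : (ltFn ∘ pr xlF mF) z = [decide (bitsToNat (xlF z) < bitsToNat (mF z))] := by simp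
    rw [cBad, iteFn_apply_false (by simp [isNilFn, h0]), notFn_apply h1] at h
    have : bitsToNat (xlF z) < bitsToNat (mF z) := by
      by_contra hlt
      simp [hlt] at h
    omega

/-- For the Rabin branch (taken only past the draw test): `|dRabF z| + |quoF dRabF z| ≤ |mF z| + 1`,
the divisor being a divisor of a positive number. [folklore] -/
theorem length_dRabF_add_le (z : List Bool) (h : cBad z = [false]) :
    (dRabF cf z).length + (quoF (dRabF cf) z).length ≤ (mF z).length + 1 := by
  have hpos := bitsToNat_mF_pos_of_cBad h
  have hd : dRabF cf z = encodeNat (Nat.gcd (bitsToNat (addFn (pr xlF (yRabF cf) z))) (bitsToNat (mF z))) := by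
    simp [dRabF]
  have hq : quoF (dRabF cf) z =
      encodeNat (bitsToNat (mF z) / Nat.gcd (bitsToNat (addFn (pr xlF (yRabF cf) z))) (bitsToNat (mF z))) := by
    simp [quoF, hd]
  rw [hd, hq]
  set v := bitsToNat (mF z) with hv
  set g := Nat.gcd (bitsToNat (addFn (pr xlF (yRabF cf) z))) v with hg
  have hm : v.size ≤ (mF z).length := by rw [hv, ← length_norm]; exact length_norm_le _
  have hgd : g ∣ v := Nat.gcd_dvd_right _ _
  have := size_add_size_div_le hgd hpos
  rw [TM2Pass.length_encodeNat_eq_size, TM2Pass.length_encodeNat_eq_size]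
  omega

/-- **Growth of one round**: `|roundG cf z| ≤ |z| + 300 (|x| + 1)` on every string `z` (with
`x = fstF z`). [folklore] -/
theorem length_roundG_le (z : List Bool) : (roundG cf z).length ≤ z.length + 300 * ((fstF z).length + 1) := by
  have hA0 : (asF z).length ≤ (asF z).length := le_rfl
  have h : Bnd (roundG cf) 300 z := by
    refine bnd_ite oneBit_cIdle (fun _ => (bnd_idleR z).mono (by norm_num)) (fun _ => ?_)
    refine bnd_ite oneBit_cEven (fun _ => ?_) (fun _ => ?_)
    · exact bnd_ite oneBit_cTwo (fun _ => (bnd_failR z hA0).mono (by norm_num))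
        (fun _ => (bnd_splitR z hA0 (length_twoF_add_le z)).mono (by norm_num))
    refine bnd_ite oneBit_cPP (fun hpp => (bnd_splitR z hA0 ((length_ppBase_add_le z hpp).trans (by omega))).mono (by norm_num))
      (fun _ => ?_)
    refine bnd_ite oneBit_cBad (fun _ => (bnd_failR z hA0).mono (by norm_num)) (fun hbad => ?_)
    refine bnd_ite oneBit_cG (fun _ => (bnd_splitR z hA0 ((length_gF_add_le z).trans (by omega))).mono (by norm_num)) (fun _ => ?_)
    exact bnd_ite oneBit_cRab (fun _ => (bnd_splitR z hA0 ((length_dRabF_add_le z hbad).trans (by omega))).mono (by norm_num))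
      (fun _ => (bnd_failR z hA0).mono (by norm_num))
  exact h

end Growth

/-! #### The rounds realise the driver -/

section Rounds

/-- **The rounds realise the Rabin driver** on the initial record: after `t` rounds the record holds
the work list and the finished numbers of `FGRabin.grun` (every work-list number is `> 1` by
Invariant 1, so `roundG_recOf_gstep` applies), the coins advanced by `t` blocks; the block values
are `ShorFP.Xc x c`. [cite: FortnowGrochow2011, Prop. 4.10 (proof: the recursion)] -/
theorem iterate_roundG_grun (x c : List Bool) {n : ℕ} (hn : 1 < n) : ∀ t : ℕ,
    (roundG cf)^[t] (recOf x c [] [(n, budget x.length)] [] []) =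
      recOf x (c.drop ((x.length + 1) * t)) []
        (FGRabin.grun (FGRabin.rabinStep (Ytab cf)) (budget x.length) (Xc x c) (winit n (budget x.length)) t).todo
        (FGRabin.grun (FGRabin.rabinStep (Ytab cf)) (budget x.length) (Xc x c) (winit n (budget x.length)) t).done []
  | 0 => by simp [winit]
  | t + 1 => by
    have ih := iterate_roundG_grun x c hn t
    set T := budget x.length with hT
    have h1 : Inv1 n (FGRabin.grun (FGRabin.rabinStep (Ytab cf)) T (Xc x c) (winit n T) t) :=
      FGRabin.inv1_grun FGRabin.rabinStep_sound (inv1_winit hn T) t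
    rw [Function.iterate_succ_apply', ih, FGRabin.grun_succ]
    rcases hs : FGRabin.grun (FGRabin.rabinStep (Ytab cf)) T (Xc x c) (winit n T) t with ⟨done, todo⟩
    rw [hs] at h1
    have hdrop : (c.drop ((x.length + 1) * t)).drop (x.length + 1) = c.drop ((x.length + 1) * (t + 1)) := by
      rw [List.drop_drop, Nat.mul_succ]
    rcases todo with _ | ⟨⟨m, k⟩, rest⟩
    · -- idle round
      have hws : FGRabin.gstep (FGRabin.rabinStep (Ytab cf)) T ⟨done, []⟩ (Xc x c t) = ⟨done, []⟩ := rfl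
      rw [hws]
      simp only []
      rw [roundG_recOf_idle, hdrop]
    · -- a splitting attempt on the top number `m > 1`
      have hm : 1 < m := h1.2 m (by simp [WState.entries])
      simp only []
      rw [roundG_recOf_gstep x (c.drop ((x.length + 1) * t)) m k rest done hm, hdrop]
      rfl

/-! #### The initial record, the rounds, the read-out -/

/-- **The initial record** from the coded pair `⟨x, c⟩` (`x = ⟨a, b⟩` the instance, `c` the coins):
`⟨x, ⟨c, ⟨[], ⟨[canon a], ⟨[T], ⟨[], []⟩⟩⟩⟩⟩⟩`. [folklore] -/
def initG : List Bool → List Bool :=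
  mk7 fstF sndF (fun _ => []) (fanoutFn (ShorFP.canonF ∘ fstF ∘ fstF) (fun _ => []))
    (fanoutFn (budget0F ∘ fstF) (fun _ => [])) (fun _ => []) (fun _ => [])

/-- `initG ∈ FP`. [folklore] -/
theorem initG_mem_FP : initG ∈ FP :=
  mk7_mem_FP fstF_mem_FP sndF_mem_FP (const_mem_FP _)
    (fanoutFn_mem_FP (comp_mem_FP ShorFP.canonF_mem_FP (comp_mem_FP fstF_mem_FP fstF_mem_FP)) (const_mem_FP _))
    (fanoutFn_mem_FP (comp_mem_FP budget0F_mem_FP fstF_mem_FP) (const_mem_FP _))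
    (const_mem_FP _) (const_mem_FP _)

/-- **The initial record is the record of the initial configuration** (the number is read off the
first component `a` of the instance `x = ⟨a, b⟩`). [folklore] -/
theorem initG_apply (x c : List Bool) :
    initG (boolPair x c) = recOf x c [] [(decodeNat (fstF x), budget x.length)] [] [] := by
  rw [recOf]
  simp [initG, mk7, encList_cons, encodeNat_decodeNat_eq_canonBits]

variable (cf) in
/-- **The rounds**: `rounds |x|` applications of `roundG cf` (`x` the first field). [folklore] -/
def iterG : List Bool → List Bool := fun r => (roundG cf)^[roundsPoly.eval (fstF r).length] r

/-- **`iterG cf ∈ FP`** for `cf ∈ FP` (`iterate_mem_FP_of_growth`: `roundG` keeps `x` and grows the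
record by at most `300 (|x| + 1)` per round). [cite: AroraBarak2009, §1.3 (bounded loops), §1.4.1] -/
theorem iterG_mem_FP (hcf : cf ∈ FP) : iterG cf ∈ FP :=
  iterate_mem_FP_of_growth (roundG_mem_FP hcf) 300 fstF_roundG length_roundG_le roundsPoly

/-- `iterG` on a record. [folklore] -/
theorem iterG_recOf (x c : List Bool) (todo : List (ℕ × ℕ)) (done : List ℕ) :
    iterG cf (recOf x c [] todo done []) = (roundG cf)^[rounds x.length] (recOf x c [] todo done []) := by
  have hx : fstF (recOf x c [] todo done []) = x := xF_recOf x c [] done [] todo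
  simp only [iterG, hx, roundsPoly_eval]

/-- **The read-out**: the code of the sorted list of the numbers declared prime. [folklore] -/
def readOutG : List Bool → List Bool := isortFn ∘ dnF

/-- `readOutG ∈ FP`. [folklore] -/
theorem readOutG_mem_FP : readOutG ∈ FP := comp_mem_FP isortFn_mem_FP (nthF_mem_FP 5)

/-- The read-out of a record: the code of the sorted `done` list. [folklore] -/
theorem readOutG_recOf (x c : List Bool) (todo : List (ℕ × ℕ)) (done : List ℕ) :
    readOutG (recOf x c [] todo done []) = encList ((done.insertionSort (· ≤ ·)).map encodeNat) := by
  simp only [readOutG, Function.comp_apply, dnF_recOf, isortFn_encList, isortModel_nil_map_encodeNat]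

variable (cf)

/-- **The output of the Rabin driver as a string function** on `⟨x, c⟩` (`x = ⟨a, b⟩` the instance,
`c` the coins): `[]` at once when `⟦a⟧ ≤ 1`, else initial record, `rounds |x|` rounds, read-out.
[cite: FortnowGrochow2011, Prop. 4.10 (proof)] -/
def driverOutF : List Bool → List Bool :=
  iteFn (valGeTwoFn ∘ ShorFP.canonF ∘ fstF ∘ fstF) (readOutG ∘ iterG cf ∘ initG) (fun _ => [])

variable {cf}

/-- **`driverOutF cf ∈ FP`** for `cf ∈ FP`. [cite: AroraBarak2009, §1.3 (closure of polynomial time under composition and bounded loops)] -/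
theorem driverOutF_mem_FP (hcf : cf ∈ FP) : driverOutF cf ∈ FP :=
  iteFn_mem_FP (comp_mem_FP valGeTwoFn_mem_FP (comp_mem_FP ShorFP.canonF_mem_FP (comp_mem_FP fstF_mem_FP fstF_mem_FP)))
    (comp_mem_FP readOutG_mem_FP (comp_mem_FP (iterG_mem_FP hcf) initG_mem_FP)) (const_mem_FP _)

/-- **`driverOutF cf` computes the code of the output of `FGRabin.rabinDriver`** (number `⟦a⟧`,
parameters of `|x|`, block `t` of the coins in round `t`). [cite: FortnowGrochow2011, Prop. 4.10 (proof)] -/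
theorem driverOutF_apply (x c : List Bool) :
    driverOutF cf (boolPair x c) =
      encList ((FGRabin.rabinDriver (Ytab cf) (decodeNat (fstF x)) (budget x.length) (rounds x.length)
        (Xof (coinBlocks (rounds x.length) (blockLen x.length) c))).map encodeNat) := by
  set n := decodeNat (fstF x) with hn
  have htest : (valGeTwoFn ∘ ShorFP.canonF ∘ fstF ∘ fstF) (boolPair x c) = [decide (2 ≤ n)] := by
    simp [valGeTwoFn, hn, bitsToNat_canonBits]
  by_cases h1 : n ≤ 1
  · rw [driverOutF, iteFn_apply_false (by rw [htest]; simp; omega)]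
    simp [FGRabin.rabinDriver, h1]
  · rw [driverOutF, iteFn_apply_true (by rw [htest]; simp; omega)]
    simp only [Function.comp_apply]
    rw [initG_apply, ← hn, iterG_recOf, iterate_roundG_grun x c (by omega) (rounds x.length), readOutG_recOf]
    have hX : FGRabin.grun (FGRabin.rabinStep (Ytab cf)) (budget x.length) (Xc x c) (winit n (budget x.length)) (rounds x.length) =
        FGRabin.grun (FGRabin.rabinStep (Ytab cf)) (budget x.length) (Xof (coinBlocks (rounds x.length) (blockLen x.length) c))
          (winit n (budget x.length)) (rounds x.length) :=
      FGRabin.grun_congr fun i hi => Xc_eq_Xof x c hi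
    rw [hX, FGRabin.rabinDriver, if_neg h1]

end Rounds

end FGRabinFP

/-! ### Assembly: `FACT ∈ RP ∩ coRP` from an `FP` canonical form for the Rabin kernel -/

namespace FGRabin

open Polynomial Brick FGRabinFP
open Literature.Computability.QuantumComplexity
open Literature.Computability.QuantumComplexity.AKSMachine (aksFn aksFn_mem_FP aksFn_encodeNat aksFn_of_ne)
open Literature.Computability.QuantumComplexity.PrattMachine (andFn_eq_true_iff orFn_eq_true_iff notFn_eq_true_iff
  ltFn_eq_true_iff eqValFn_eq_true_iff allFn_eq_true_iff valGeTwoFn_eq_true_iff)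
open Literature.NumberTheory.Primality (AKS.aksDecide_eq_true_iff)

/-! #### The canonical form is a square-root table -/

/-- The Rabin function on a coded pair: `rabinFn ⟨m, x⟩ = ⟨m, x² mod m⟩`. [cite: FortnowGrochow2011, Prop. 4.10 (proof)] -/
theorem rabinFn_boolPair (m x : ℕ) :
    rabinFn (boolPair (encodeNat m) (encodeNat x)) = boolPair (encodeNat m) (encodeNat (x ^ 2 % m)) := by
  simp [rabinFn, decode_encodeNat]

variable {cf : List Bool → List Bool}

/-- **A canonical form of the Rabin kernel returns square roots**: `(Ytab cf m x)² ≡ x² (mod m)`.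
[cite: FortnowGrochow2011, Prop. 4.10 (proof: "Then x² ≡ y² (mod N)")] -/
theorem Ytab_sq (hcan : IsCanonicalFormFor (fun u v => rabinFn u = rabinFn v) cf) (m x : ℕ) :
    (Ytab cf m x) ^ 2 % m = x ^ 2 % m := by
  have h := hcan.1 (boolPair (encodeNat m) (encodeNat x))
  dsimp only at h
  rw [rabinFn_boolPair] at h
  set w := cf (boolPair (encodeNat m) (encodeNat x)) with hw
  have h' := congrArg boolUnpair h
  simp only [rabinFn, boolUnpair_boolPair, Prod.mk.injEq] at h'
  obtain ⟨h1, h2⟩ := h'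
  rw [h1, decode_encodeNat] at h2
  have := congrArg bitsToNat h2
  simp only [bitsToNat_encodeNat] at this
  rw [Ytab, ← hw]
  exact this

/-- **… depending only on the square**: `x² ≡ x'² (mod m)` implies `Ytab cf m x = Ytab cf m x'`.
[cite: FortnowGrochow2011, §2.2 (canonical form: x ~ y → f(x) = f(y))] -/
theorem Ytab_congr (hcan : IsCanonicalFormFor (fun u v => rabinFn u = rabinFn v) cf) (m x x' : ℕ)
    (h : x ^ 2 % m = x' ^ 2 % m) : Ytab cf m x = Ytab cf m x' := by
  have hrel : rabinFn (boolPair (encodeNat m) (encodeNat x)) = rabinFn (boolPair (encodeNat m) (encodeNat x')) := by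
    rw [rabinFn_boolPair, rabinFn_boolPair, h]
  have := hcan.2 _ _ hrel
  rw [Ytab, Ytab, this]

/-! #### The `RP` verifier -/

/-- The degenerate members `N = 0 ∧ 2 ≤ k` (every `d` divides `0`). [folklore] -/
def zeroMemFn : List Bool → List Bool :=
  andFn (notFn (ltFn ∘ fanoutFn (fun _ => []) (fstF ∘ fstF))) (notFn (ltFn ∘ fanoutFn (sndF ∘ fstF) (fun _ => encodeNat 2)))

/-- `zeroMemFn ∈ FP`. [folklore] -/
theorem zeroMemFn_mem_FP : zeroMemFn ∈ FP :=
  andFn_mem_FP (notFn_mem_FP (comp_mem_FP ltFn_mem_FP (fanoutFn_mem_FP (const_mem_FP _) (comp_mem_FP fstF_mem_FP fstF_mem_FP))))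
    (notFn_mem_FP (comp_mem_FP ltFn_mem_FP (fanoutFn_mem_FP (comp_mem_FP sndF_mem_FP fstF_mem_FP) (const_mem_FP _))))

/-- `zeroMemFn` is one-bit. [folklore] -/
theorem oneBit_zeroMemFn : OneBit zeroMemFn := oneBit_andFn (oneBit_notFn (oneBit_ltFn.comp _)) (oneBit_notFn (oneBit_ltFn.comp _))

/-- Truth of `zeroMemFn` on a pair. [folklore] -/
theorem zeroMemFn_eq_true_iff (x y : List Bool) :
    zeroMemFn (boolPair x y) = [true] ↔ bitsToNat (fstF x) = 0 ∧ 2 ≤ bitsToNat (sndF x) := by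
  rw [zeroMemFn, andFn_eq_true_iff (oneBit_notFn (oneBit_ltFn.comp _)) (oneBit_notFn (oneBit_ltFn.comp _)),
    notFn_eq_true_iff (oneBit_ltFn.comp _), notFn_eq_true_iff (oneBit_ltFn.comp _)]
  simp only [Function.comp_apply, fanoutFn_apply, fstF_boolPair, ltFn_eq_true_iff, bitsToNat_nil,
    bitsToNat_encodeNat, not_lt, Nat.le_zero]

variable (cf)

/-- **The `RP` verifier** on `w = ⟨x, r⟩`: the instance is valid and degenerate-positive
(`N = 0 ∧ 2 ≤ k`), or the head of the driver's output on coins `r` is a divisor `1 < d ≤ k` of `N`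
(the `NP` verifier `factVerFn` of `FactoringNP.lean` fed with that head).
[cite: FortnowGrochow2011, Prop. 4.10 (proof)] -/
def rpVerFn : List Bool → List Bool :=
  orFn (andFn FactCoNP.validXFn zeroMemFn) (factVerFn ∘ fanoutFn fstF (fstF ∘ driverOutF cf))

variable {cf}

/-- `rpVerFn cf ∈ FP` for `cf ∈ FP`. [cite: AroraBarak2009, §1.3] -/
theorem rpVerFn_mem_FP (hcf : cf ∈ FP) : rpVerFn cf ∈ FP :=
  orFn_mem_FP (andFn_mem_FP (comp_mem_FP eqPairFn_mem_FP (fanoutFn_mem_FP fstF_mem_FP (comp_mem_FP renormFn_mem_FP fstF_mem_FP))) zeroMemFn_mem_FP)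
    (comp_mem_FP factVerFn_mem_FP (fanoutFn_mem_FP fstF_mem_FP (comp_mem_FP fstF_mem_FP (driverOutF_mem_FP hcf))))

/-- `rpVerFn cf` is one-bit. [folklore] -/
theorem oneBit_rpVerFn : OneBit (rpVerFn cf) :=
  oneBit_orFn (oneBit_andFn FactCoNP.oneBit_validXFn oneBit_zeroMemFn) (oneBit_factVerFn.comp _)

/-- **Truth of the `RP` verifier on a pair.** [folklore] -/
theorem rpVerFn_eq_true_iff (x y : List Bool) :
    rpVerFn cf (boolPair x y) = [true] ↔
      (x = renormFn x ∧ bitsToNat (fstF x) = 0 ∧ 2 ≤ bitsToNat (sndF x)) ∨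
        factVerFn (boolPair x (fstF (driverOutF cf (boolPair x y)))) = [true] := by
  rw [rpVerFn, orFn_eq_true_iff (oneBit_andFn FactCoNP.oneBit_validXFn oneBit_zeroMemFn) (oneBit_factVerFn.comp _),
    andFn_eq_true_iff FactCoNP.oneBit_validXFn oneBit_zeroMemFn, zeroMemFn_eq_true_iff]
  simp only [FactCoNP.validXFn, Function.comp_apply, fanoutFn_apply, fstF_boolPair, eqPairFn_boolPair,
    List.singleton_inj, decide_eq_true_eq]

/-- **No false positives**: the `RP` verifier accepts `⟨x, y⟩` only if `x ∈ FACT`.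
[cite: FortnowGrochow2011, Prop. 4.10 (proof: a found gcd is a genuine factor)] -/
theorem mem_FACT_of_rpVerFn {x y : List Bool} (h : rpVerFn cf (boolPair x y) = [true]) : x ∈ FACT := by
  rw [rpVerFn_eq_true_iff x y] at h
  rw [mem_FACT_iff]
  rcases h with ⟨hval, hN, hk⟩ | h
  · obtain ⟨N, k, rfl⟩ := (eq_renorm_iff x).1 hval
    simp only [fstF_boolPair, sndF_boolPair, bitsToNat_encodeNat] at hN hk
    subst hN
    exact ⟨0, k, rfl, (zero_mem_factSet_iff k).2 hk⟩
  · rw [factVerFn_boolPair] at h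
    simp only [List.singleton_inj, decide_eq_true_eq] at h
    obtain ⟨hval, h1, hle, hmod⟩ := h
    obtain ⟨N, k, rfl⟩ := (eq_renorm_iff x).1 hval
    simp only [fstF_boolPair, sndF_boolPair, bitsToNat_encodeNat] at hle hmod
    exact ⟨N, k, rfl, _, h1, hle, Nat.dvd_of_mod_eq_zero hmod⟩

/-! #### The `coRP` verifier -/

/-- `aksFn` is one-bit. [folklore] -/
theorem oneBit_aksMachineFn : OneBit aksFn := fun w => by
  by_cases h : encodeNat (bitsToNat w) = w
  · rw [← h, aksFn_encodeNat]; exact ⟨_, rfl⟩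
  · exact ⟨false, aksFn_of_ne h⟩

/-- `aksFn w = 1` iff `w` is the canonical numeral of a prime. [cite: AgrawalKayalSaxena2004, Thm 4.1] -/
theorem aksFn_eq_true_iff (w : List Bool) : aksFn w = [true] ↔ encodeNat (bitsToNat w) = w ∧ (bitsToNat w).Prime := by
  constructor
  · intro h
    by_cases hc : encodeNat (bitsToNat w) = w
    · refine ⟨hc, ?_⟩
      rw [← hc, aksFn_encodeNat, List.singleton_inj, AKS.aksDecide_eq_true_iff] at h
      simpa using h
    · rw [aksFn_of_ne hc] at h; simp at h
  · rintro ⟨hc, hp⟩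
    rw [← hc, aksFn_encodeNat, List.singleton_inj, AKS.aksDecide_eq_true_iff]
    simpa using hp

/-- The item test of the `coRP` verifier on `⟨x, a⟩`: `k < ⟦a⟧` and `a` is an AKS-certified prime.
[cite: FortnowGrochow2011, Prop. 4.10 (proof: primality "can be determined in polynomial time [AKS]")] -/
def primeGtFn : List Bool → List Bool := andFn (ltFn ∘ fanoutFn (sndF ∘ fstF) sndF) (aksFn ∘ sndF)

/-- `primeGtFn ∈ FP`. [folklore] -/
theorem primeGtFn_mem_FP : primeGtFn ∈ FP :=
  andFn_mem_FP (comp_mem_FP ltFn_mem_FP (fanoutFn_mem_FP (comp_mem_FP sndF_mem_FP fstF_mem_FP) sndF_mem_FP)) (comp_mem_FP aksFn_mem_FP sndF_mem_FP)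

/-- `primeGtFn` is one-bit. [folklore] -/
theorem oneBit_primeGtFn : OneBit primeGtFn := oneBit_andFn (oneBit_ltFn.comp _) (oneBit_aksMachineFn.comp _)

/-- Truth of the item test. [folklore] -/
theorem primeGtFn_eq_true_iff (x a : List Bool) :
    primeGtFn (boolPair x a) = [true] ↔ bitsToNat (sndF x) < bitsToNat a ∧ encodeNat (bitsToNat a) = a ∧ (bitsToNat a).Prime := by
  rw [primeGtFn, andFn_eq_true_iff (oneBit_ltFn.comp _) (oneBit_aksMachineFn.comp _)]
  simp only [Function.comp_apply, fanoutFn_apply, fstF_boolPair, sndF_boolPair, ltFn_eq_true_iff, aksFn_eq_true_iff]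

/-- The degenerate non-member `N = 1`. [folklore] -/
def oneCaseFn : List Bool → List Bool := eqValFn ∘ fanoutFn (fstF ∘ fstF) (fun _ => [true])

/-- `oneCaseFn ∈ FP`. [folklore] -/
theorem oneCaseFn_mem_FP : oneCaseFn ∈ FP :=
  comp_mem_FP eqValFn_mem_FP (fanoutFn_mem_FP (comp_mem_FP fstF_mem_FP fstF_mem_FP) (const_mem_FP _))

/-- `oneCaseFn` is one-bit. [folklore] -/
theorem oneBit_oneCaseFn : OneBit oneCaseFn := oneBit_eqValFn.comp _

variable (cf) in
/-- The certificate test of the `coRP` verifier on `w = ⟨x, r⟩`: `N ≥ 2`, the driver's output has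
product `N`, and each of its items is an AKS-certified prime `> k`. [cite: FortnowGrochow2011, Prop. 4.10 (proof)] -/
def coCertFn : List Bool → List Bool :=
  andFn (valGeTwoFn ∘ fstF ∘ fstF)
    (andFn (eqValFn ∘ fanoutFn (prodListFn ∘ fanoutFn (fun _ => []) (driverOutF cf)) (fstF ∘ fstF))
      (allFn primeGtFn ∘ fanoutFn fstF (driverOutF cf)))

/-- `coCertFn cf ∈ FP` for `cf ∈ FP`. [cite: AroraBarak2009, §1.3] -/
theorem coCertFn_mem_FP (hcf : cf ∈ FP) : coCertFn cf ∈ FP :=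
  andFn_mem_FP (comp_mem_FP valGeTwoFn_mem_FP (comp_mem_FP fstF_mem_FP fstF_mem_FP))
    (andFn_mem_FP (comp_mem_FP eqValFn_mem_FP (fanoutFn_mem_FP (comp_mem_FP prodListFn_mem_FP
        (fanoutFn_mem_FP (const_mem_FP _) (driverOutF_mem_FP hcf))) (comp_mem_FP fstF_mem_FP fstF_mem_FP)))
      (comp_mem_FP (allFn_mem_FP primeGtFn_mem_FP oneBit_primeGtFn) (fanoutFn_mem_FP fstF_mem_FP (driverOutF_mem_FP hcf))))

/-- `coCertFn cf` is one-bit. [folklore] -/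
theorem oneBit_coCertFn : OneBit (coCertFn cf) :=
  oneBit_andFn (oneBit_valGeTwoFn.comp _) (oneBit_andFn (oneBit_eqValFn.comp _) ((oneBit_allFn oneBit_primeGtFn).comp _))

/-- **Truth of the certificate test on a pair.** [folklore] -/
theorem coCertFn_eq_true_iff (x y : List Bool) :
    coCertFn cf (boolPair x y) = [true] ↔
      2 ≤ bitsToNat (fstF x) ∧ ((decNil (driverOutF cf (boolPair x y))).map bitsToNat).prod = bitsToNat (fstF x) ∧
        ∀ a ∈ decNil (driverOutF cf (boolPair x y)),
          bitsToNat (sndF x) < bitsToNat a ∧ encodeNat (bitsToNat a) = a ∧ (bitsToNat a).Prime := by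
  rw [coCertFn, andFn_eq_true_iff (oneBit_valGeTwoFn.comp _) (oneBit_andFn (oneBit_eqValFn.comp _) ((oneBit_allFn oneBit_primeGtFn).comp _)),
    andFn_eq_true_iff (oneBit_eqValFn.comp _) ((oneBit_allFn oneBit_primeGtFn).comp _)]
  simp only [Function.comp_apply, fanoutFn_apply, fstF_boolPair, valGeTwoFn_eq_true_iff, eqValFn_eq_true_iff,
    prodListFn_boolPair, bitsToNat_encodeNat, allFn_eq_true_iff oneBit_primeGtFn, primeGtFn_eq_true_iff]

variable (cf)

/-- **The `coRP` verifier** on `w = ⟨x, r⟩`: the instance is malformed, or degenerate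
(`N = 0 ∧ k ≤ 1`, or `N = 1`), or the certificate test passes on the driver's output.
[cite: FortnowGrochow2011, Prop. 4.10 (proof)] -/
def coVerFn : List Bool → List Bool :=
  orFn (notFn FactCoNP.validXFn) (orFn FactCoNP.zeroCaseFn (orFn oneCaseFn (coCertFn cf)))

variable {cf}

/-- `coVerFn cf ∈ FP` for `cf ∈ FP`. [cite: AroraBarak2009, §1.3] -/
theorem coVerFn_mem_FP (hcf : cf ∈ FP) : coVerFn cf ∈ FP := by
  have hA : FactCoNP.wA ∈ FP := comp_mem_FP fstF_mem_FP fstF_mem_FP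
  have hB : FactCoNP.wB ∈ FP := comp_mem_FP sndF_mem_FP fstF_mem_FP
  exact orFn_mem_FP (notFn_mem_FP (comp_mem_FP eqPairFn_mem_FP (fanoutFn_mem_FP fstF_mem_FP (comp_mem_FP renormFn_mem_FP fstF_mem_FP))))
    (orFn_mem_FP (andFn_mem_FP (notFn_mem_FP (comp_mem_FP ltFn_mem_FP (fanoutFn_mem_FP (const_mem_FP _) hA)))
      (comp_mem_FP ltFn_mem_FP (fanoutFn_mem_FP hB (const_mem_FP _)))) (orFn_mem_FP oneCaseFn_mem_FP (coCertFn_mem_FP hcf)))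

/-- `coVerFn cf` is one-bit. [folklore] -/
theorem oneBit_coVerFn : OneBit (coVerFn cf) :=
  oneBit_orFn (oneBit_notFn FactCoNP.oneBit_validXFn) (oneBit_orFn FactCoNP.oneBit_zeroCaseFn (oneBit_orFn oneBit_oneCaseFn oneBit_coCertFn))

/-- **Truth of the `coRP` verifier on a pair.** [folklore] -/
theorem coVerFn_eq_true_iff (x y : List Bool) :
    coVerFn cf (boolPair x y) = [true] ↔
      ¬ x = renormFn x ∨ (bitsToNat (fstF x) = 0 ∧ bitsToNat (sndF x) < 2) ∨ bitsToNat (fstF x) = 1 ∨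
        coCertFn cf (boolPair x y) = [true] := by
  rw [coVerFn, orFn_eq_true_iff (oneBit_notFn FactCoNP.oneBit_validXFn)
      (oneBit_orFn FactCoNP.oneBit_zeroCaseFn (oneBit_orFn oneBit_oneCaseFn oneBit_coCertFn)),
    orFn_eq_true_iff FactCoNP.oneBit_zeroCaseFn (oneBit_orFn oneBit_oneCaseFn oneBit_coCertFn),
    orFn_eq_true_iff oneBit_oneCaseFn oneBit_coCertFn, notFn_eq_true_iff FactCoNP.oneBit_validXFn, FactCoNP.zeroCaseFn,
    andFn_eq_true_iff (oneBit_notFn (oneBit_ltFn.comp _)) (oneBit_ltFn.comp _), notFn_eq_true_iff (oneBit_ltFn.comp _)]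
  simp only [FactCoNP.validXFn, oneCaseFn, Function.comp_apply, fanoutFn_apply, fstF_boolPair, eqPairFn_boolPair,
    FactCoNP.wA, FactCoNP.wB, ltFn_eq_true_iff, eqValFn_eq_true_iff, bitsToNat_nil, bitsToNat_encodeNat,
    List.singleton_inj, decide_eq_true_eq, Nat.pos_iff_ne_zero, not_not]
  simp

/-- **No false positives**: the `coRP` verifier accepts `⟨x, y⟩` only if `x ∉ FACT` (a list of
certified primes `> k` with product `N` leaves no divisor `1 < d ≤ k`).
[cite: FortnowGrochow2011, Prop. 4.10 (proof)] -/
theorem not_mem_FACT_of_coVerFn {x y : List Bool} (h : coVerFn cf (boolPair x y) = [true]) : x ∉ FACT := by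
  rw [coVerFn_eq_true_iff x y] at h
  rintro hx
  obtain ⟨N, k, rfl, hNk⟩ := (mem_FACT_iff _).1 hx
  rcases h with hval | ⟨hN0, hk⟩ | hN1 | hcert
  · exact hval ((eq_renorm_iff _).2 ⟨N, k, rfl⟩)
  · simp only [fstF_boolPair, sndF_boolPair, bitsToNat_encodeNat] at hN0 hk
    subst hN0
    exact absurd ((zero_mem_factSet_iff k).1 hNk) (by omega)
  · simp only [fstF_boolPair, bitsToNat_encodeNat] at hN1
    subst hN1
    exact one_not_mem_factSet k hNk
  · rw [coCertFn_eq_true_iff _ y] at hcert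
    simp only [fstF_boolPair, sndF_boolPair, bitsToNat_encodeNat] at hcert
    obtain ⟨-, hprod, hall⟩ := hcert
    obtain ⟨d, h1, hdk, hdN⟩ := hNk
    refine not_dvd_of_prime_factorisation hprod (fun p hp => ?_) h1 hdk hdN
    obtain ⟨a, ha, rfl⟩ := List.mem_map.1 hp
    exact ⟨(hall a ha).1, (hall a ha).2.2⟩

/-! #### Completeness: the driver succeeds with probability `≥ 3/4` -/

/-- The coin polynomial `64 (X + 1)³`. [folklore] -/
def coinPoly : Polynomial ℕ := 64 * (X + 1) ^ 3

/-- `coinPoly` evaluates to `Shor1997.coinLen`. [folklore] -/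
theorem coinPoly_eval (L : ℕ) : coinPoly.eval L = coinLen L := by
  simp [coinPoly, coinLen_eq]

/-- The number of a valid instance is within the block length: `N < 2^{|⟨N, k⟩| + 1}`. [folklore] -/
theorem lt_two_pow_length_succ (N k : ℕ) : N < 2 ^ ((boolPair (encodeNat N) (encodeNat k)).length + 1) := by
  have h := Cryptography.decodeNat_lt (encodeNat N)
  rw [decode_encodeNat] at h
  refine lt_of_lt_of_le h (Nat.pow_le_pow_right (by norm_num) ?_)
  rw [length_boolPair]; omega

/-- **The success event implies acceptance by both verifiers.** On coins `r` for which the driver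
outputs `primeFactorsList N` (`N ≥ 2`): the `RP` verifier accepts when `(N, k) ∈ factSet`
(the head `minFac N ≤ k`), and the `coRP` verifier accepts when `(N, k) ∉ factSet` (all primes
`> k`, certified by AKS). [cite: FortnowGrochow2011, Prop. 4.10 (proof)] -/
theorem verifiers_of_success {N k : ℕ} (hN : 2 ≤ N)
    {r : List Bool}
    (hr : rabinDriver (Ytab cf) N (budget (boolPair (encodeNat N) (encodeNat k)).length)
      (rounds (boolPair (encodeNat N) (encodeNat k)).length)
      (Xof (coinBlocks (rounds (boolPair (encodeNat N) (encodeNat k)).length)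
        (blockLen (boolPair (encodeNat N) (encodeNat k)).length) r)) = N.primeFactorsList) :
    ((N, k) ∈ factSet → rpVerFn cf (boolPair (boolPair (encodeNat N) (encodeNat k)) r) = [true]) ∧
    ((N, k) ∉ factSet → coVerFn cf (boolPair (boolPair (encodeNat N) (encodeNat k)) r) = [true]) := by
  set x := boolPair (encodeNat N) (encodeNat k) with hx
  have hout : driverOutF cf (boolPair x r) = encList (N.primeFactorsList.map encodeNat) := by
    rw [driverOutF_apply, hx, fstF_boolPair, decode_encodeNat, ← hx, hr]
  have hval : x = renormFn x := (eq_renorm_iff x).2 ⟨N, k, rfl⟩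
  obtain ⟨n, rfl⟩ : ∃ n, N = n + 2 := ⟨N - 2, by omega⟩
  constructor
  · intro hmem
    rw [rpVerFn_eq_true_iff x r]
    right
    rw [hout, Nat.primeFactorsList_add_two, List.map_cons, encList_cons, fstF_boolPair, factVerFn_boolPair]
    simp only [hx, fstF_boolPair, sndF_boolPair, bitsToNat_encodeNat, List.singleton_inj, decide_eq_true_eq]
    refine ⟨by rw [← hx]; exact hval, (Nat.minFac_prime (by omega)).one_lt, ?_, Nat.mod_eq_zero_of_dvd (Nat.minFac_dvd _)⟩
    exact (mem_factSet_iff_minFac_le (by omega) k).1 hmem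
  · intro hnot
    rw [coVerFn_eq_true_iff x r]
    right; right; right
    rw [coCertFn_eq_true_iff x r, hout]
    simp only [hx, fstF_boolPair, sndF_boolPair, bitsToNat_encodeNat, decNil_encList, List.map_map, List.forall_mem_map]
    refine ⟨by omega, ?_, fun p hp => ⟨?_, by simp, ?_⟩⟩
    · have : (fun q => bitsToNat (encodeNat q)) = id := funext fun q => bitsToNat_encodeNat q
      rw [show (bitsToNat ∘ encodeNat) = id from this, List.map_id]
      exact Nat.prod_primeFactorsList (by omega)
    · by_contra hle
      exact hnot ⟨p, (Nat.prime_of_mem_primeFactorsList hp).one_lt, Nat.le_of_not_lt hle, Nat.dvd_of_mem_primeFactorsList hp⟩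
    · simpa using Nat.prime_of_mem_primeFactorsList hp

/-- **The success probability on a valid instance with `N ≥ 2`** (`rabinDriver_success` with the
square-root table of the canonical form). [cite: FortnowGrochow2011, Prop. 4.10 (proof)] -/
theorem uniformProb_success (hcan : IsCanonicalFormFor (fun u v => rabinFn u = rabinFn v) cf) (N k : ℕ) :
    3 / 4 ≤ uniformProb (coinPoly.eval (boolPair (encodeNat N) (encodeNat k)).length)
      {r | rabinDriver (Ytab cf) N (budget (boolPair (encodeNat N) (encodeNat k)).length)
        (rounds (boolPair (encodeNat N) (encodeNat k)).length)
        (Xof (coinBlocks (rounds (boolPair (encodeNat N) (encodeNat k)).length)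
          (blockLen (boolPair (encodeNat N) (encodeNat k)).length) r)) = N.primeFactorsList} := by
  rw [coinPoly_eval]
  exact rabinDriver_success (Ytab_sq hcan) (Ytab_congr hcan) _ (lt_two_pow_length_succ N k)

/-! #### `FACT ∈ RP`, `FACTᶜ ∈ RP`, and the discharge -/

variable (cf) in
/-- The language of the `RP` verifier. [folklore] -/
def rpLang : Language Bool := {w | rpVerFn cf w = [true]}

variable (cf) in
/-- The language of the `coRP` verifier. [folklore] -/
def coLang : Language Bool := {w | coVerFn cf w = [true]}

/-- Membership in `rpLang`. [folklore] -/
theorem mem_rpLang {w : List Bool} : w ∈ rpLang cf ↔ rpVerFn cf w = [true] := Iff.rfl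

/-- Membership in `coLang`. [folklore] -/
theorem mem_coLang {w : List Bool} : w ∈ coLang cf ↔ coVerFn cf w = [true] := Iff.rfl

/-- **`rpLang cf ∈ P`** for `cf ∈ FP`. [cite: AroraBarak2009, Def. 1.13] -/
theorem rpLang_mem_P (hcf : cf ∈ FP) : rpLang cf ∈ Classes.P :=
  mem_P_of_mem_FP (rpVerFn_mem_FP hcf) _ fun _ => ⟨fun h => h, fun h => oneBit_rpVerFn.eq_false_of_ne_true h⟩

/-- **`coLang cf ∈ P`** for `cf ∈ FP`. [cite: AroraBarak2009, Def. 1.13] -/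
theorem coLang_mem_P (hcf : cf ∈ FP) : coLang cf ∈ Classes.P :=
  mem_P_of_mem_FP (coVerFn_mem_FP hcf) _ fun _ => ⟨fun h => h, fun h => oneBit_coVerFn.eq_false_of_ne_true h⟩

/-- **`FACT ∈ RP`** given an `FP` canonical form for the Rabin kernel. [cite: FortnowGrochow2011, Prop. 4.10] -/
theorem FACT_mem_RP (hcf : cf ∈ FP) (hcan : IsCanonicalFormFor (fun u v => rabinFn u = rabinFn v) cf) : FACT ∈ RP := by
  refine ⟨rpLang cf, rpLang_mem_P hcf, coinPoly, fun x => ⟨fun hx => ?_, fun hx y _ hy => hx (mem_FACT_of_rpVerFn (mem_rpLang.1 hy))⟩⟩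
  obtain ⟨N, k, rfl, hNk⟩ := (mem_FACT_iff x).1 hx
  rcases Nat.lt_or_ge N 2 with hN | hN
  · -- `N = 0` (as `(1, k) ∉ factSet`): every coin string is accepted
    have hN0 : N = 0 := by
      rcases (Nat.lt_succ_iff.1 hN).lt_or_eq with h | h
      · omega
      · exact absurd hNk (h ▸ one_not_mem_factSet k)
    subst hN0
    have hk := (zero_mem_factSet_iff k).1 hNk
    have huniv : {y : List Bool | boolPair (boolPair (encodeNat 0) (encodeNat k)) y ∈ rpLang cf} = Set.univ := by
      refine Set.eq_univ_of_forall fun y => ?_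
      rw [Set.mem_setOf_eq, mem_rpLang, rpVerFn_eq_true_iff _ y]
      left
      refine ⟨(eq_renorm_iff _).2 ⟨0, k, rfl⟩, ?_, ?_⟩ <;> simp [hk]
    rw [huniv, uniformProb_univ]; norm_num
  · refine le_trans (by norm_num) ((uniformProb_success hcan N k).trans (Cryptography.uniformProb_mono _ fun r hr => ?_))
    exact mem_rpLang.2 ((verifiers_of_success hN hr).1 hNk)

/-- **`FACTᶜ ∈ RP`** (i.e. `FACT ∈ coRP`) given an `FP` canonical form for the Rabin kernel.
[cite: FortnowGrochow2011, Prop. 4.10] -/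
theorem FACT_compl_mem_RP (hcf : cf ∈ FP) (hcan : IsCanonicalFormFor (fun u v => rabinFn u = rabinFn v) cf) : FACTᶜ ∈ RP := by
  refine ⟨coLang cf, coLang_mem_P hcf, coinPoly, fun x => ⟨fun hx => ?_, fun hx y _ hy => ?_⟩⟩
  · have hx' : x ∉ FACT := hx
    by_cases hval : x = renormFn x
    · obtain ⟨N, k, rfl⟩ := (eq_renorm_iff x).1 hval
      have hNk : (N, k) ∉ factSet := fun h => hx' ((mem_FACT_iff _).2 ⟨N, k, rfl, h⟩)
      rcases Nat.lt_or_ge N 2 with hN | hN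
      · -- degenerate instances: every coin string is accepted
        have huniv : {y : List Bool | boolPair (boolPair (encodeNat N) (encodeNat k)) y ∈ coLang cf} = Set.univ := by
          refine Set.eq_univ_of_forall fun y => ?_
          rw [Set.mem_setOf_eq, mem_coLang, coVerFn_eq_true_iff _ y]
          simp only [fstF_boolPair, sndF_boolPair, bitsToNat_encodeNat]
          rcases (Nat.lt_succ_iff.1 hN).lt_or_eq with h | h
          · have hN0 : N = 0 := by omega
            subst hN0
            have : ¬ 2 ≤ k := fun hk => hNk ((zero_mem_factSet_iff k).2 hk)
            exact Or.inr (Or.inl ⟨rfl, by omega⟩)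
          · exact Or.inr (Or.inr (Or.inl h))
        rw [huniv, uniformProb_univ]; norm_num
      · refine le_trans (by norm_num) ((uniformProb_success hcan N k).trans (Cryptography.uniformProb_mono _ fun r hr => ?_))
        exact mem_coLang.2 ((verifiers_of_success hN hr).2 hNk)
    · -- malformed instances: every coin string is accepted
      have huniv : {y : List Bool | boolPair x y ∈ coLang cf} = Set.univ := by
        refine Set.eq_univ_of_forall fun y => ?_
        rw [Set.mem_setOf_eq, mem_coLang, coVerFn_eq_true_iff x y]
        exact Or.inl hval
      rw [huniv, uniformProb_univ]; norm_num
  · exact absurd (show x ∈ FACT from not_not.1 hx) (not_mem_FACT_of_coVerFn (mem_coLang.1 hy))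

end FGRabin

/-- **Discharge of `fortnowGrochow_rabinKernel_factoring`** (Fortnow–Grochow 2011, proof of
Prop. 4.10): an `FP` canonical form for the kernel of the Rabin function `⟨N, x⟩ ↦ ⟨N, x² mod N⟩`
puts `FACT` in `ZPP = RP ∩ coRP`. Random `x`, `y = c⟨N, x⟩`, `gcd(x + y, N)` splits an odd composite
non-prime-power `N` with probability `≥ 1/2` over the units (`FGRabin.two_mul_card_badRabin_le`);
recursion on the factors with `32(|x|+1)` attempts per number factors `N` completely with probability
`≥ 3/4` (`FGRabin.rabinDriver_success`, the tree's Shor driver with the Rabin step); the driver is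
polynomial time (`FGRabinFP.driverOutF_mem_FP`); zero error on both sides because a divisor, resp. an
AKS-certified prime factorisation, is checked (`FGRabin.FACT_mem_RP`, `FGRabin.FACT_compl_mem_RP`).
[cite: FortnowGrochow2011, Prop. 4.10 (proof)] -/
theorem fortnowGrochow_rabinKernel_factoring_holds : fortnowGrochow_rabinKernel_factoring := by
  rintro ⟨cf, hcf, hcan⟩
  exact ⟨FGRabin.FACT_mem_RP hcf hcan, FGRabin.FACT_compl_mem_RP hcf hcan⟩

end Literature.Computability.Complexity

end
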